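import Summits.QuantumFields.YangMills.Theses.PoincareLipschitz
import Summits.QuantumFields.YangMills.Theorems.PoincareLipschitzTwoSidedOfConcentrationStep
import Summits.QuantumFields.YangMills.Theorems.PoincareLipschitzTwoSidedOfConcentrationCounting
import Summits.QuantumFields.YangMills.Theorems.PoincareLipschitzTwoSidedOfConcentrationBudget
import Summits.QuantumFields.YangMills.Theorems.UnitScaleTiltHistoryTailBoundedHeightLocal
import Summits.QuantumFields.YangMills.Theorems.FibreConvexityTailDefs
import Literature.MathematicalPhysics.QuantumFieldTheory.Balaban1983to89.T3UnitScaleTilt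
import Literature.MathematicalPhysics.QuantumFieldTheory.Balaban1983to89.T4PairDerivBridge
import Summits.QuantumFields.YangMills.Theses.RevelationMartingale
import HarnessLib

/-!
# LINE 27 «MedianCentring» — ONE-FILE REDUCTION: `MeanDeviationShallowL` (stmt-QuantumFields-23133) ⇐ K1 ∧ K2 ∧ (Q), SORRY-FREE

Concatenation of the workfiles `Lines/median_centring_localtail.lean` (§T: stub (T) sorry-free, commit 6a018803b609) and `Lines/median_centring_mean.lean`
(§A budget lemmas = P4, §B–§C: stub (M) sorry-free, commit 8e8f516b8768), followed by §D, the composition reaching the registered target BY NAME.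
Hypotheses left open: K1 `PoincareLipschitz.MesoscopicConcentrationL` (stmt-23532), K2 `PoincareLipschitz.BlockLipschitzL` (stmt-23533), and the
3/4-quantile statement (Q) = `stub_quantileDeviation` of `Lines/median_centring.lean` (which is itself implied by `PoincareLipschitz.MeanDeviationL`,
`Lines/median_centring_markov.lean`, commit a3f7f5afa36c).  No crux, rung (R3 = YM₃ on T³; NOT d = 4, NOT Clay) or summit is proved; YM is NOT proved.
-/

/-!
# LINE 27 «MedianCentring» — support workfile: STUB (T) `stub_localTailOfMedian` SORRY-FREE

`local_tail_median : K1 → K2 → (Q) → (local window tail)` — the text of stub (T) of `Cruxes/HistoryTailL/Lines/median_centring.lean` — proved by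
re-running the landed ✓`local_step` / ✓`local_tail` (PoincareLipschitzTwoSidedOfConcentration{Step,}) with the MEAN hypothesis replaced by the
3/4-QUANTILE (Q): the McShane proxy `g` (✓`exists_capped_infConvolution`) has `g ≤ f` on `G` and `g = θ` on `G ∩ {θ ≤ f}`; (Q) and the budget
`Gibbs(Gᶜ) ≤ 1/4` put mass `≥ 1/2` on `{g ≤ θ/8}`, so K1 applied to `−g` (lower tail at `5θ/8`) forces `∫ g < 3θ/4` as soon as
`Cc·e^{−(25/4)c₁p²} < 1/2` (`eta_small`: true for `γ ≤ γ_η`); then `{θ ≤ f} ∩ G ⊆ {θ/4 ≤ g − ∫ g}` and K1's upper tail gives the landed exponent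
`c₁ = cc/(4624(CL+1)²)`.  K1 = `MesoscopicConcentrationL`, K2 = `BlockLipschitzL` remain HYPOTHESES (open cruxes); (Q) remains OPEN; no crux, rung
(R3 = YM₃ on T³; NOT d = 4, NOT Clay) or summit is proved; the Yang–Mills mass gap is NOT proved.
-/

namespace Summit.QuantumFields.YangMills.Cruxes.HistoryTailL.MedianCentring

open MeasureTheory
open scoped BigOperators
open Literature.MathematicalPhysics.QuantumFieldTheory.Balaban1983to89
open Literature.MathematicalPhysics.QuantumFieldTheory.Balaban1983to89.T3ContinuumYM3Torus
open Literature.MathematicalPhysics.QuantumFieldTheory.Balaban1983to89.T3UnitScaleTilt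
open Literature.MathematicalPhysics.QuantumFieldTheory.Balaban1983to89.T3UnitLawDensityEML (ℰp measurableE_ℰp)
open Literature.MathematicalPhysics.QuantumFieldTheory.Balaban1983to89.T3OrbitAverage
open Literature.MathematicalPhysics.QuantumFieldTheory.Balaban1983to89.T3MinimiserStabilityReduction (θBal_pos)
open Literature.MathematicalPhysics.QuantumFieldTheory.Balaban1983to89.T3FinestHeightTail (beta_mul_θBal_sq)
open Literature.MathematicalPhysics.QuantumFieldTheory.Balaban1983to89.T4PairDerivBridge (dist1_le_two_specialUnitaryGroup)
open Summit.QuantumFields.YangMills.Theorems.HistoryTailBoundedHeightLocal (perPlaquette_boundedHeight_uniform)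
open Summit.QuantumFields.YangMills.Theorems.PoincareLipschitz.TwoSidedOfConcentration

/-- The smallness `Cc·exp(−(25/4)κ p(g_h)²) < 1/2` for `γ ≤ γ_η`, uniformly in the height `h` (`p(g)² ≥ b₀²(log g⁻¹)² ≥ b₀²X²` for
`γ ≤ e^{−2X}`). [folklore] -/
theorem eta_small {Cc κ b₀ p₀ : ℝ} (hCc : 0 ≤ Cc) (hκ : 0 < κ) (hb₀ : 0 < b₀) (hp₀ : 1 ≤ p₀) {L : ℕ} (hL : 1 ≤ L) :
    ∃ γη : ℝ, 0 < γη ∧ γη ≤ 1 ∧ ∀ γ : ℝ, 0 < γ → γ ≤ γη → ∀ h : ℕ,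
      Cc * Real.exp (-(25 / 4 * (κ * B10.pFun b₀ p₀ (Real.sqrt (γ * ((L : ℝ)⁻¹) ^ h)) ^ 2))) < 1 / 2 := by
  set X : ℝ := Real.log (2 * Cc + 2) / (κ * b₀ ^ 2) + 1 with hX
  have hlog : 0 < Real.log (2 * Cc + 2) := Real.log_pos (by linarith)
  have hκb : 0 < κ * b₀ ^ 2 := by positivity
  have hX1 : 1 ≤ X := by rw [hX]; have := div_pos hlog hκb; linarith
  have hX0 : 0 ≤ X := by linarith
  refine ⟨min 1 (Real.exp (-(2 * X))), by positivity, min_le_left _ _, fun γ hγ hγη h => ?_⟩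
  have hγ1 : γ ≤ 1 := hγη.trans (min_le_left _ _)
  have hγX : γ ≤ Real.exp (-(2 * X)) := hγη.trans (min_le_right _ _)
  obtain ⟨hg, hg1, _, _⟩ := coupling_basic hL hγ hγ1 h
  have hx := log_inv_coupling_ge hL hγ hγ1 hγX h
  set x := Real.log (Real.sqrt (γ * ((L : ℝ)⁻¹) ^ h))⁻¹ with hxdef
  have hp := sq_log_le_pFun_sq (b₀ := b₀) (p₀ := p₀) hp₀ hg hg1
  rw [← hxdef] at hp
  -- `κ p² ≥ κ b₀² x² ≥ κ b₀² X ≥ log(2Cc+2)`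
  have hx2 : X ≤ x ^ 2 := by nlinarith
  have hmain : Real.log (2 * Cc + 2) ≤ 25 / 4 * (κ * B10.pFun b₀ p₀ (Real.sqrt (γ * ((L : ℝ)⁻¹) ^ h)) ^ 2) := by
    have h1 : Real.log (2 * Cc + 2) ≤ κ * b₀ ^ 2 * X := by
      rw [hX, mul_add, mul_div_cancel₀ _ hκb.ne']
      linarith
    have h2 : κ * b₀ ^ 2 * X ≤ κ * (b₀ ^ 2 * x ^ 2) := by
      rw [← mul_assoc]; exact mul_le_mul_of_nonneg_left hx2 hκb.le
    have h3 : κ * (b₀ ^ 2 * x ^ 2) ≤ κ * B10.pFun b₀ p₀ (Real.sqrt (γ * ((L : ℝ)⁻¹) ^ h)) ^ 2 :=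
      mul_le_mul_of_nonneg_left hp hκ.le
    have h4 : 0 ≤ κ * B10.pFun b₀ p₀ (Real.sqrt (γ * ((L : ℝ)⁻¹) ^ h)) ^ 2 := by positivity
    linarith
  have hexp : Real.exp (-(25 / 4 * (κ * B10.pFun b₀ p₀ (Real.sqrt (γ * ((L : ℝ)⁻¹) ^ h)) ^ 2))) ≤ 1 / (2 * Cc + 2) := by
    have h2 : Real.exp (-(Real.log (2 * Cc + 2))) = 1 / (2 * Cc + 2) := by
      rw [Real.exp_neg, Real.exp_log (by linarith), one_div]
    rw [← h2]
    exact Real.exp_le_exp.mpr (neg_le_neg hmain)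
  calc Cc * Real.exp (-(25 / 4 * (κ * B10.pFun b₀ p₀ (Real.sqrt (γ * ((L : ℝ)⁻¹) ^ h)) ^ 2)))
      ≤ Cc * (1 / (2 * Cc + 2)) := mul_le_mul_of_nonneg_left hexp hCc
    _ < 1 / 2 := by
        rw [mul_one_div, div_lt_iff₀ (by linarith : (0 : ℝ) < 2 * Cc + 2)]
        linarith

/-- **THE ONE-HEIGHT STEP, MEDIAN VERSION** — ✓`local_step` with the mean hypothesis replaced by the 3/4-quantile `(hQ)` and the smallness `(hη)`.
[adapted from ✓`PoincareLipschitzTwoSidedOfConcentrationStep.local_step`; cite: Balaban1985UV3, (3) p.256 and (7) p.257] -/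
theorem local_step_median (F : T3Family) {γ b₀ p₀ : ℝ} (hγ : 0 < γ) (hγ2 : γ ≤ 1 / 2) (hb₀ : 0 < b₀)
    {K j : ℕ} (hjK : j + 2 ≤ K) (a : Plaq (F.P K) j) {Cc cc CL : ℝ} (hCL : 0 ≤ CL)
    (hK1 : ∀ (n : ℕ), 1 ≤ n → (n : ℝ) ≤ (F.scheme ℰp γ).β K → 2 * n ≤ (F.P K).sitesPerDir 0 →
      ∀ (x₀ : Site (F.P K) 0) (f : GaugeField (F.P K) 0 (Matrix.specialUnitaryGroup (Fin 2) ℂ) → ℝ) (Λ : ℝ), 0 < Λ → Measurable f → GaugeField.GaugeInvariant f →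
      (∀ U U' : GaugeField (F.P K) 0 (Matrix.specialUnitaryGroup (Fin 2) ℂ), (∀ b : PBond (F.P K) 0, (∀ k, (b.src k - x₀ k).val < n) → (∀ k, (b.tgt k - x₀ k).val < n) → U b = U' b) →
        f U = f U') →
      (∀ U U' : GaugeField (F.P K) 0 (Matrix.specialUnitaryGroup (Fin 2) ℂ), |f U - f U'| ≤ Λ * Real.sqrt (∑ b : PBond (F.P K) 0, GaugeGroup.dist1 (U b * (U' b)⁻¹) ^ 2)) →
      ∀ r : ℝ, 0 ≤ r → (gibbsK F ℰp γ K).real {U | r ≤ f U - ∫ V, f V ∂(gibbsK F ℰp γ K)} ≤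
        Cc * Real.exp (-(cc * (F.scheme ℰp γ).β K * r ^ 2 / ((n : ℝ) ^ 2 * Λ ^ 2))))
    (hK2 : ∀ U U' : GaugeField (F.P K) 0 (Matrix.specialUnitaryGroup (Fin 2) ℂ), (∀ (i : ℕ) (q : Plaq (F.P K) i), i < j → Site.tdist (fun k => ((((q.src k).val * F.L ^ i : ℕ)) : ZMod ((F.P K).sitesPerDir 0))) (fun k => ((((a.src k).val * F.L ^ j : ℕ)) : ZMod ((F.P K).sitesPerDir 0))) + 64 * F.L ^ i ≤ 64 * F.L ^ j → GaugeGroup.dist1 (GaugeField.plaqHol (Averaging.iter (fun i' => BlockAveraging.blockAvg (P := F.P K) (j := i') ℰp) i U) q) < θBal F.L γ b₀ p₀ (K - i)) → (∀ (i : ℕ) (q : Plaq (F.P K) i), i < j → Site.tdist (fun k => ((((q.src k).val * F.L ^ i : ℕ)) : ZMod ((F.P K).sitesPerDir 0))) (fun k => ((((a.src k).val * F.L ^ j : ℕ)) : ZMod ((F.P K).sitesPerDir 0))) + 64 * F.L ^ i ≤ 64 * F.L ^ j → GaugeGroup.dist1 (GaugeField.plaqHol (Averaging.iter (fun i' =>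 BlockAveraging.blockAvg (P := F.P K) (j := i') ℰp) i U') q) < θBal F.L γ b₀ p₀ (K - i)) →
      |GaugeGroup.dist1 (GaugeField.plaqHol (Averaging.iter (fun i' => BlockAveraging.blockAvg (P := F.P K) (j := i') ℰp) j U) a) - GaugeGroup.dist1 (GaugeField.plaqHol (Averaging.iter (fun i' => BlockAveraging.blockAvg (P := F.P K) (j := i') ℰp) j U') a)| ≤ CL / Real.sqrt ((F.L : ℝ) ^ j) * Real.sqrt (∑ b : PBond (F.P K) 0, if (∀ k, (b.src k - ((((a.src k).val * F.L ^ j : ℕ)) : ZMod ((F.P K).sitesPerDir 0)) + ((8 * F.L ^ j : ℕ) : ZMod ((F.P K).sitesPerDir 0))).val < 17 * F.L ^ j) ∧ (∀ k, (b.tgt k - ((((a.src k).val * F.L ^ j : ℕ)) : ZMod ((F.P K).sitesPerDir 0)) + ((8 * F.L ^ j : ℕ) : ZMod ((F.P K).sitesPerDir 0))).val < 17 * F.L ^ j) then GaugeGroup.dist1 (U b * (U' b)⁻¹) ^ 2 else 0))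
    (hQ : 3 / 4 ≤ (gibbsK F ℰp γ K).real {U : GaugeField (F.P K) 0 (Matrix.specialUnitaryGroup (Fin 2) ℂ) | GaugeGroup.dist1 (GaugeField.plaqHol (Averaging.iter (fun i' => BlockAveraging.blockAvg (P := F.P K) (j := i') ℰp) j U) a) ≤ θBal F.L γ b₀ p₀ (K - j) / 8})
    (hη : Cc * Real.exp (-(25 / 4 * (cc / (4624 * (CL + 1) ^ 2) * B10.pFun b₀ p₀ (Real.sqrt (γ * ((F.L : ℝ)⁻¹) ^ (K - j))) ^ 2))) < 1 / 2)
    (hGc : (gibbsK F ℰp γ K).real {U : GaugeField (F.P K) 0 (Matrix.specialUnitaryGroup (Fin 2) ℂ) | (∀ (i : ℕ) (q : Plaq (F.P K) i), i < j → Site.tdist (fun k => ((((q.src k).val * F.L ^ i : ℕ)) : ZMod ((F.P K).sitesPerDir 0))) (fun k => ((((a.src k).val * F.L ^ j : ℕ)) : ZMod ((F.P K).sitesPerDir 0))) + 64 * F.L ^ i ≤ 64 * F.L ^ j → GaugeGroup.dist1 (GaugeField.plaqHol (Averaging.iter (fun i' => BlockAveraging.blockAvg (P := F.P K) (j := i')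 ℰp) i U) q) < θBal F.L γ b₀ p₀ (K - i))}ᶜ ≤ 1 / 4) :
    (gibbsK F ℰp γ K).real ({U : GaugeField (F.P K) 0 (Matrix.specialUnitaryGroup (Fin 2) ℂ) | θBal F.L γ b₀ p₀ (K - j) ≤ GaugeGroup.dist1 (GaugeField.plaqHol (Averaging.iter (fun i' => BlockAveraging.blockAvg (P := F.P K) (j := i') ℰp) j U) a)} ∩ {U : GaugeField (F.P K) 0 (Matrix.specialUnitaryGroup (Fin 2) ℂ) | (∀ (i : ℕ) (q : Plaq (F.P K) i), i < j → Site.tdist (fun k => ((((q.src k).val * F.L ^ i : ℕ)) : ZMod ((F.P K).sitesPerDir 0))) (fun k => ((((a.src k).val * F.L ^ j : ℕ)) : ZMod ((F.P K).sitesPerDir 0))) + 64 * F.L ^ i ≤ 64 * F.L ^ j → GaugeGroup.dist1 (GaugeField.plaqHol (Averaging.iter (fun i' => BlockAveraging.blockAvg (P := F.P K) (j := i') ℰp) i U) q) < θBal F.L γ b₀ p₀ (K - i))}) ≤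
      Cc * Real.exp (-(cc / (4624 * (CL + 1) ^ 2) * B10.pFun b₀ p₀ (Real.sqrt (γ * ((F.L : ℝ)⁻¹) ^ (K - j))) ^ 2)) := by
  haveI := isProbabilityMeasure_gibbsK F ℰp hγ.le K
  have hγ1 : γ ≤ 1 := by linarith
  have hL1 : 1 ≤ F.L := F.hL.2.le
  have hL3 : 3 ≤ F.L := by obtain ⟨k, hk⟩ := F.hL.1; have := F.hL.2; omega
  have hLr : (3 : ℝ) ≤ F.L := by exact_mod_cast hL3
  set μ := gibbsK F ℰp γ K with hμ
  set θ := θBal F.L γ b₀ p₀ (K - j) with hθ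
  have hθpos : 0 < θ := θBal_pos hL1 hγ hγ1 hb₀ p₀ (K - j)
  have hLj : (0 : ℝ) < (F.L : ℝ) ^ j := by positivity
  have hsq : 0 < Real.sqrt ((F.L : ℝ) ^ j) := Real.sqrt_pos.mpr hLj
  set Λ : ℝ := (CL + 1) / Real.sqrt ((F.L : ℝ) ^ j) with hΛ
  have hΛpos : 0 < Λ := div_pos (by linarith) hsq
  set f : GaugeField (F.P K) 0 (Matrix.specialUnitaryGroup (Fin 2) ℂ) → ℝ := fun U => GaugeGroup.dist1 (GaugeField.plaqHol (Averaging.iter (fun i' => BlockAveraging.blockAvg (P := F.P K) (j := i') ℰp) j U) a) with hf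
  set G : Set (GaugeField (F.P K) 0 (Matrix.specialUnitaryGroup (Fin 2) ℂ)) := {U : GaugeField (F.P K) 0 (Matrix.specialUnitaryGroup (Fin 2) ℂ) | (∀ (i : ℕ) (q : Plaq (F.P K) i), i < j → Site.tdist (fun k => ((((q.src k).val * F.L ^ i : ℕ)) : ZMod ((F.P K).sitesPerDir 0))) (fun k => ((((a.src k).val * F.L ^ j : ℕ)) : ZMod ((F.P K).sitesPerDir 0))) + 64 * F.L ^ i ≤ 64 * F.L ^ j → GaugeGroup.dist1 (GaugeField.plaqHol (Averaging.iter (fun i' => BlockAveraging.blockAvg (P := F.P K) (j := i') ℰp) i U) q) < θBal F.L γ b₀ p₀ (K - i))} with hG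
  set d : GaugeField (F.P K) 0 (Matrix.specialUnitaryGroup (Fin 2) ℂ) → GaugeField (F.P K) 0 (Matrix.specialUnitaryGroup (Fin 2) ℂ) → ℝ := fun U U' => Real.sqrt (∑ b : PBond (F.P K) 0, if (∀ k, (b.src k - ((((a.src k).val * F.L ^ j : ℕ)) : ZMod ((F.P K).sitesPerDir 0)) + ((8 * F.L ^ j : ℕ) : ZMod ((F.P K).sitesPerDir 0))).val < 17 * F.L ^ j) ∧ (∀ k, (b.tgt k - ((((a.src k).val * F.L ^ j : ℕ)) : ZMod ((F.P K).sitesPerDir 0)) + ((8 * F.L ^ j : ℕ) : ZMod ((F.P K).sitesPerDir 0))).val < 17 * F.L ^ j) then GaugeGroup.dist1 (U b * (U' b)⁻¹) ^ 2 else 0) with hd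
  -- §1 the McShane extension
  obtain ⟨g, hg0, hgθ, hgf, hgeq, hgLip, hginv, hgloc, hgmeas⟩ :=
    exists_capped_infConvolution d (fun U U' => boxLinkDist_nonneg _ U U') (fun U => boxLinkDist_self _ U)
      (fun U U' => boxLinkDist_comm _ U U') (fun U U' U'' => boxLinkDist_triangle _ U U' U'')
      (fun U' => continuous_boxLinkDist _ U') G f (fun U => GaugeGroup.dist1_nonneg _) θ Λ hθpos.le hΛpos.le
      (fun U hU U' hU' => (hK2 U U' hU hU').trans
        (mul_le_mul_of_nonneg_right (div_le_div_of_nonneg_right (by linarith) hsq.le) (Real.sqrt_nonneg _)))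
      (GaugeField.gaugeAct (P := F.P K) (j := 0) (G := (Matrix.specialUnitaryGroup (Fin 2) ℂ)))
      (fun u U hU => by
        simp only [hG, Set.mem_setOf_eq] at hU ⊢
        intro i q hi hnear
        rw [dist1_plaqHol_iter_gaugeAct F (by omega) q u U]
        exact hU i q hi hnear)
      (fun u U => by simp only [hf]; exact dist1_plaqHol_iter_gaugeAct F (by omega) a u U)
      (fun u U U' => boxLinkDist_gaugeAct _ u U U')
      (fun u => ⟨fun x => (u x)⁻¹, gaugeAct_gaugeAct_inv u⟩)
      (fun U U' => ∀ b : PBond (F.P K) 0, (∀ k, (b.src k - ((((a.src k).val * F.L ^ j : ℕ)) : ZMod ((F.P K).sitesPerDir 0)) + ((8 * F.L ^ j : ℕ) : ZMod ((F.P K).sitesPerDir 0))).val < 17 * F.L ^ j) ∧ (∀ k, (b.tgt k - ((((a.src k).val * F.L ^ j : ℕ)) : ZMod ((F.P K).sitesPerDir 0)) + ((8 * F.L ^ j : ℕ) : ZMod ((F.P K).sitesPerDir 0))).val < 17 * F.L ^ j) → U b = U' b)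
      (fun U U' h V => boxLinkDist_congr_left _ h V)
  -- §2 integrability and the mean of `g`
  have hmeas : ∀ (i : ℕ) (q : Plaq (F.P K) i), Measurable fun U : GaugeField (F.P K) 0 (Matrix.specialUnitaryGroup (Fin 2) ℂ) =>
      GaugeGroup.dist1 (GaugeField.plaqHol (Averaging.iter (fun i' => BlockAveraging.blockAvg (P := F.P K) (j := i') ℰp) i U) q) :=
    fun i q => RegularGaugeGroup.measurable_dist1.comp ((Missing.measurable_plaqHol q).comp
      (T4Continuum.measurable_iter _ (F.avgMeasurable_of_measurableE ℰp measurableE_ℰp K) i))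
  have hf_meas : Measurable f := hmeas j a
  have hf_int : Integrable f μ :=
    Integrable.mono' (integrable_const (2 : ℝ)) hf_meas.aestronglyMeasurable
      (ae_of_all _ fun U => by
        rw [Real.norm_eq_abs, abs_of_nonneg (GaugeGroup.dist1_nonneg _)]
        exact dist1_le_two_specialUnitaryGroup _)
  have hg_int : Integrable g μ :=
    Integrable.mono' (integrable_const θ) hgmeas.aestronglyMeasurable
      (ae_of_all _ fun U => by rw [Real.norm_eq_abs, abs_of_nonneg (hg0 U)]; exact hgθ U)
  have hG_meas : MeasurableSet G := by
    have hGeq : G = ⋂ (i : ℕ), ⋂ (q : Plaq (F.P K) i),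
        {U : GaugeField (F.P K) 0 (Matrix.specialUnitaryGroup (Fin 2) ℂ) | i < j → Site.tdist (fun k => ((((q.src k).val * F.L ^ i : ℕ)) : ZMod ((F.P K).sitesPerDir 0))) (fun k => ((((a.src k).val * F.L ^ j : ℕ)) : ZMod ((F.P K).sitesPerDir 0))) + 64 * F.L ^ i ≤ 64 * F.L ^ j → GaugeGroup.dist1 (GaugeField.plaqHol (Averaging.iter (fun i' => BlockAveraging.blockAvg (P := F.P K) (j := i') ℰp) i U) q) < θBal F.L γ b₀ p₀ (K - i)} := by
      ext U
      simp only [hG, Set.mem_setOf_eq, Set.mem_iInter]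
    rw [hGeq]
    refine MeasurableSet.iInter fun i => MeasurableSet.iInter fun q => ?_
    by_cases hc : i < j ∧ Site.tdist (fun k => ((((q.src k).val * F.L ^ i : ℕ)) : ZMod ((F.P K).sitesPerDir 0))) (fun k => ((((a.src k).val * F.L ^ j : ℕ)) : ZMod ((F.P K).sitesPerDir 0))) + 64 * F.L ^ i ≤ 64 * F.L ^ j
    · have hset : {U : GaugeField (F.P K) 0 (Matrix.specialUnitaryGroup (Fin 2) ℂ) | i < j → Site.tdist (fun k => ((((q.src k).val * F.L ^ i : ℕ)) : ZMod ((F.P K).sitesPerDir 0))) (fun k => ((((a.src k).val * F.L ^ j : ℕ)) : ZMod ((F.P K).sitesPerDir 0))) + 64 * F.L ^ i ≤ 64 * F.L ^ j → GaugeGroup.dist1 (GaugeField.plaqHol (Averaging.iter (fun i' => BlockAveraging.blockAvg (P := F.P K) (j := i') ℰp) i U) q) < θBal F.L γ b₀ p₀ (K - i)} =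
          {U : GaugeField (F.P K) 0 (Matrix.specialUnitaryGroup (Fin 2) ℂ) | GaugeGroup.dist1 (GaugeField.plaqHol (Averaging.iter (fun i' => BlockAveraging.blockAvg (P := F.P K) (j := i') ℰp) i U) q) < θBal F.L γ b₀ p₀ (K - i)} := by
        ext U
        simp only [Set.mem_setOf_eq]
        exact ⟨fun h => h hc.1 hc.2, fun h _ _ => h⟩
      rw [hset]
      exact measurableSet_lt (hmeas i q) measurable_const
    · have hset : {U : GaugeField (F.P K) 0 (Matrix.specialUnitaryGroup (Fin 2) ℂ) | i < j → Site.tdist (fun k => ((((q.src k).val * F.L ^ i : ℕ)) : ZMod ((F.P K).sitesPerDir 0))) (fun k => ((((a.src k).val * F.L ^ j : ℕ)) : ZMod ((F.P K).sitesPerDir 0))) + 64 * F.L ^ i ≤ 64 * F.L ^ j → GaugeGroup.dist1 (GaugeField.plaqHol (Averaging.iter (fun i' => BlockAveraging.blockAvg (P := F.P K) (j := i') ℰp) i U) q) < θBal F.L γ b₀ p₀ (K - i)} = Set.univ := by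
        ext U
        simp only [Set.mem_setOf_eq, Set.mem_univ, iff_true]
        intro h1 h2
        exact absurd ⟨h1, h2⟩ hc
      rw [hset]
      exact MeasurableSet.univ
  -- §4 the box: side `n = 17 L^j`, corner `corner(a) L^j − 8 L^j`
  have h1n : 1 ≤ 17 * F.L ^ j := by
    have : 1 ≤ F.L ^ j := Nat.one_le_pow _ _ (by omega)
    omega
  have h2n : 2 * (17 * F.L ^ j) ≤ (F.P K).sitesPerDir 0 := by
    have hN0 : (F.P K).sitesPerDir 0 = 2 * F.L ^ (F.m + K) := by simp [Params.sitesPerDir]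
    rw [hN0]
    have hsplit : F.L ^ (F.m + K) = F.L ^ j * F.L ^ (F.m + K - j) := by rw [← pow_add]; congr 1; omega
    have h27 : 27 ≤ F.L ^ (F.m + K - j) :=
      calc 27 = 3 ^ 3 := by norm_num
        _ ≤ F.L ^ 3 := Nat.pow_le_pow_left hL3 3
        _ ≤ F.L ^ (F.m + K - j) := Nat.pow_le_pow_right (by omega) (by have := F.hm; omega)
    rw [hsplit]
    nlinarith
  have hβK : (F.scheme ℰp γ).β K = (F.L : ℝ) ^ K / γ := by
    show (γ * (F.P K).eps)⁻¹ = _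
    have heps : (F.P K).eps = ((F.L : ℝ)⁻¹) ^ K := rfl
    rw [heps, mul_inv, inv_pow, inv_inv, div_eq_inv_mul]
  have hnβ : ((17 * F.L ^ j : ℕ) : ℝ) ≤ (F.scheme ℰp γ).β K := by
    rw [hβK, le_div_iff₀ hγ]
    push_cast
    have hsplit : (F.L : ℝ) ^ K = (F.L : ℝ) ^ j * (F.L : ℝ) ^ (K - j) := by rw [← pow_add]; congr 1; omega
    have h9 : (9 : ℝ) ≤ (F.L : ℝ) ^ (K - j) :=
      calc (9 : ℝ) = 3 ^ 2 := by norm_num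
        _ ≤ (F.L : ℝ) ^ 2 := pow_le_pow_left₀ (by norm_num) hLr 2
        _ ≤ (F.L : ℝ) ^ (K - j) := pow_le_pow_right₀ (by linarith) (by omega)
    rw [hsplit]
    nlinarith
  set x₀ : Site (F.P K) 0 := fun k => ((((a.src k).val * F.L ^ j : ℕ)) : ZMod ((F.P K).sitesPerDir 0)) - ((8 * F.L ^ j : ℕ) : ZMod ((F.P K).sitesPerDir 0)) with hx₀
  have hbox : ∀ U U' : GaugeField (F.P K) 0 (Matrix.specialUnitaryGroup (Fin 2) ℂ), (∀ b : PBond (F.P K) 0, (∀ k, (b.src k - x₀ k).val < 17 * F.L ^ j) →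
      (∀ k, (b.tgt k - x₀ k).val < 17 * F.L ^ j) → U b = U' b) → g U = g U' := by
    intro U U' h
    refine hgloc U U' fun b hb => h b (fun k => ?_) (fun k => ?_)
    · have hk : b.src k - x₀ k = b.src k - ((((a.src k).val * F.L ^ j : ℕ)) : ZMod ((F.P K).sitesPerDir 0)) + ((8 * F.L ^ j : ℕ) : ZMod ((F.P K).sitesPerDir 0)) := by
        simp only [hx₀]; ring
      rw [hk]; exact hb.1 k
    · have hk : b.tgt k - x₀ k = b.tgt k - ((((a.src k).val * F.L ^ j : ℕ)) : ZMod ((F.P K).sitesPerDir 0)) + ((8 * F.L ^ j : ℕ) : ZMod ((F.P K).sitesPerDir 0)) := by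
        simp only [hx₀]; ring
      rw [hk]; exact hb.2 k
  have hLipg : ∀ U U' : GaugeField (F.P K) 0 (Matrix.specialUnitaryGroup (Fin 2) ℂ), |g U - g U'| ≤
      Λ * Real.sqrt (∑ b : PBond (F.P K) 0, GaugeGroup.dist1 (U b * (U' b)⁻¹) ^ 2) :=
    fun U U' => (hgLip U U').trans (mul_le_mul_of_nonneg_left (boxLinkDist_le_linkDist _ U U') hΛpos.le)
  have hK := hK1 (17 * F.L ^ j) h1n hnβ h2n x₀ g Λ hΛpos hgmeas hginv hbox hLipg (θ / 4) (by positivity)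
  -- §5 exponent bookkeeping
  have hKsplit : K - j + j = K := Nat.sub_add_cancel (by omega)
  have hβLj : (F.scheme ℰp γ).β K = (F.L : ℝ) ^ j * (F.scheme ℰp γ).β (K - j) := by
    show (γ * (F.P K).eps)⁻¹ = (F.L : ℝ) ^ j * (γ * (F.P (K - j)).eps)⁻¹
    have he1 : (F.P K).eps = ((F.L : ℝ)⁻¹) ^ K := rfl
    have he2 : (F.P (K - j)).eps = ((F.L : ℝ)⁻¹) ^ (K - j) := rfl
    have hL0 : (F.L : ℝ) ≠ 0 := by positivity
    rw [he1, he2]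
    conv_lhs => rw [← hKsplit]
    rw [pow_add, inv_pow, inv_pow]
    field_simp
  have hβθ : (F.scheme ℰp γ).β K * θ ^ 2 =
      (F.L : ℝ) ^ j * B10.pFun b₀ p₀ (Real.sqrt (γ * ((F.L : ℝ)⁻¹) ^ (K - j))) ^ 2 := by
    rw [hβLj, mul_assoc, beta_mul_θBal_sq F hγ b₀ p₀ (K - j)]
  have hnΛ : (((17 * F.L ^ j : ℕ)) : ℝ) ^ 2 * Λ ^ 2 = 289 * (CL + 1) ^ 2 * (F.L : ℝ) ^ j := by
    rw [hΛ, div_pow, Real.sq_sqrt hLj.le]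
    push_cast
    field_simp
    ring
  have hexp : cc * (F.scheme ℰp γ).β K * (θ / 4) ^ 2 / ((((17 * F.L ^ j : ℕ)) : ℝ) ^ 2 * Λ ^ 2) =
      cc / (4624 * (CL + 1) ^ 2) * B10.pFun b₀ p₀ (Real.sqrt (γ * ((F.L : ℝ)⁻¹) ^ (K - j))) ^ 2 := by
    have h1 : cc * (F.scheme ℰp γ).β K * (θ / 4) ^ 2 = cc * ((F.scheme ℰp γ).β K * θ ^ 2) / 16 := by ring
    rw [h1, hβθ, hnΛ]
    have hCL1 : (CL + 1) ≠ 0 := by linarith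
    field_simp
    ring
  -- §5b (MedianCentring) the lower tail of `g` at `r = 5θ/8`: K1 applied to `-g`
  have hK' := hK1 (17 * F.L ^ j) h1n hnβ h2n x₀ (fun U => -g U) Λ hΛpos hgmeas.neg
    (fun u U => by simp only [hginv u U]) (fun U U' h => by simp only [hbox U U' h])
    (fun U U' => by
      rw [show -g U - -g U' = -(g U - g U') by ring, abs_neg]
      exact hLipg U U')
    (5 * θ / 8) (by positivity)
  have hexp' : cc * (F.scheme ℰp γ).β K * (5 * θ / 8) ^ 2 / ((((17 * F.L ^ j : ℕ)) : ℝ) ^ 2 * Λ ^ 2) =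
      25 / 4 * (cc / (4624 * (CL + 1) ^ 2) * B10.pFun b₀ p₀ (Real.sqrt (γ * ((F.L : ℝ)⁻¹) ^ (K - j))) ^ 2) := by
    rw [← hexp]; ring
  -- §5c (MedianCentring) the mean of `g` lies below `3θ/4`: else the quantile event would sit in the lower tail of `g`
  have hint_g : ∫ U, g U ∂μ < 3 * θ / 4 := by
    by_contra hcon
    rw [not_lt] at hcon
    have hhalf : 1 / 2 ≤ μ.real ({U | f U ≤ θ / 8} ∩ G) := by
      have hcov : {U | f U ≤ θ / 8} ⊆ ({U | f U ≤ θ / 8} ∩ G) ∪ Gᶜ := by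
        intro U hU
        by_cases hUG : U ∈ G
        · exact Or.inl ⟨hU, hUG⟩
        · exact Or.inr hUG
      have h1 : μ.real {U | f U ≤ θ / 8} ≤ μ.real ({U | f U ≤ θ / 8} ∩ G) + μ.real Gᶜ :=
        (measureReal_mono hcov (measure_ne_top _ _)).trans (measureReal_union_le _ _)
      have hQ' : 3 / 4 ≤ μ.real {U | f U ≤ θ / 8} := hQ
      linarith [hGc]
    have hsub' : ({U | f U ≤ θ / 8} ∩ G) ⊆ {U | 5 * θ / 8 ≤ (fun U => -g U) U - ∫ V, (fun U => -g U) V ∂μ} := by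
      rintro U ⟨hU1, hU2⟩
      simp only [Set.mem_setOf_eq] at hU1 ⊢
      rw [integral_neg]
      have := hgf U hU2
      linarith
    have hlow := (measureReal_mono hsub' (measure_ne_top _ _)).trans hK'
    rw [hexp'] at hlow
    linarith [hη, hhalf, hlow]
  -- §3 the event sits in the upper tail of `g`
  have hsub : ({U : GaugeField (F.P K) 0 (Matrix.specialUnitaryGroup (Fin 2) ℂ) | θ ≤ f U} ∩ G) ⊆ {U | θ / 4 ≤ g U - ∫ V, g V ∂μ} := by
    rintro U ⟨hU1, hU2⟩
    simp only [Set.mem_setOf_eq] at hU1 ⊢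
    rw [hgeq U hU2 hU1]
    linarith
  -- §6 conclude
  calc μ.real ({U : GaugeField (F.P K) 0 (Matrix.specialUnitaryGroup (Fin 2) ℂ) | θ ≤ f U} ∩ G)
      ≤ μ.real {U | θ / 4 ≤ g U - ∫ V, g V ∂μ} := measureReal_mono hsub (measure_ne_top _ _)
    _ ≤ Cc * Real.exp (-(cc * (F.scheme ℰp γ).β K * (θ / 4) ^ 2 / ((((17 * F.L ^ j : ℕ)) : ℝ) ^ 2 * Λ ^ 2))) := hK
    _ = Cc * Real.exp (-(cc / (4624 * (CL + 1) ^ 2) * B10.pFun b₀ p₀ (Real.sqrt (γ * ((F.L : ℝ)⁻¹) ^ (K - j))) ^ 2)) := by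
        rw [hexp]

/-- **STUB (T) OF LINE 27, SORRY-FREE: the local window tail from K1, K2 and the quantile (Q).**  Statement = `stub_localTailOfMedian` of
`Cruxes/HistoryTailL/Lines/median_centring.lean` (K1, K2, (Q) as hypotheses).  [adapted from ✓`local_tail`; cite: Balaban1985UV3, (7) p.257, (71) p.273] -/
theorem local_tail_median (hC : Summit.QuantumFields.YangMills.Theses.PoincareLipschitz.MesoscopicConcentrationL)
    (hLip : Summit.QuantumFields.YangMills.Theses.PoincareLipschitz.BlockLipschitzL)
    (hQ : ∀ (L : ℕ) (b₀ p₀ : ℝ), 0 < b₀ → 2 < p₀ → ∃ γ₁ : ℝ, 0 < γ₁ ∧ γ₁ ≤ 1 ∧ ∀ (F : T3Family) (γ : ℝ), F.L = L → 0 < γ → γ ≤ γ₁ →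
          ∀ (K j : ℕ), 1 ≤ j → j + 2 ≤ K → ∀ a : Plaq (F.P K) j,
            3 / 4 ≤ (gibbsK F ℰp γ K).real {U : GaugeField (F.P K) 0 (Matrix.specialUnitaryGroup (Fin 2) ℂ) | GaugeGroup.dist1 (GaugeField.plaqHol (Averaging.iter (fun i' => BlockAveraging.blockAvg (P := F.P K) (j := i') ℰp) j U) a) ≤ θBal F.L γ b₀ p₀ (K - j) / 8})
    (L : ℕ) {b₀ p₀ : ℝ} (hb₀ : 0 < b₀) (hp₀ : 2 < p₀) :
    ∃ (γ₁ C c : ℝ), 0 < γ₁ ∧ γ₁ ≤ 1 ∧ 0 ≤ C ∧ 0 < c ∧ ∀ (F : T3Family) (γ : ℝ), F.L = L → 0 < γ → γ ≤ γ₁ →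
      ∀ (K j : ℕ), 1 ≤ j → j + 2 ≤ K → ∀ a : Plaq (F.P K) j,
        (gibbsK F ℰp γ K).real ({U : GaugeField (F.P K) 0 (Matrix.specialUnitaryGroup (Fin 2) ℂ) | θBal F.L γ b₀ p₀ (K - j) ≤ GaugeGroup.dist1 (GaugeField.plaqHol (Averaging.iter (fun i' => BlockAveraging.blockAvg (P := F.P K) (j := i') ℰp) j U) a)} ∩ {U : GaugeField (F.P K) 0 (Matrix.specialUnitaryGroup (Fin 2) ℂ) | (∀ (i : ℕ) (q : Plaq (F.P K) i), i < j → Site.tdist (fun k => ((((q.src k).val * F.L ^ i : ℕ)) : ZMod ((F.P K).sitesPerDir 0))) (fun k => ((((a.src k).val * F.L ^ j : ℕ)) : ZMod ((F.P K).sitesPerDir 0))) + 64 * F.L ^ i ≤ 64 * F.L ^ j → GaugeGroup.dist1 (GaugeField.plaqHol (Averaging.iter (fun i' => BlockAveraging.blockAvg (P := F.P K) (j := i') ℰp) i U) q) < θBal F.L γ b₀ p₀ (K - i))}) ≤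
          C * Real.exp (-(c * B10.pFun b₀ p₀ (Real.sqrt (γ * ((F.L : ℝ)⁻¹) ^ (K - j))) ^ 2)) := by
  -- the constants of the three hypotheses and of the level-0 input
  obtain ⟨Cc, cc, hCc, hcc, γC, hγC, hγC1, HC⟩ := hC L
  obtain ⟨CL, hCL, HLip⟩ := hLip L
  obtain ⟨γLip, hγLip, hγLip1, HLip'⟩ := HLip b₀ p₀ hb₀ hp₀
  obtain ⟨γM, hγM, hγM1, HM⟩ := hQ L b₀ p₀ hb₀ hp₀
  obtain ⟨C₀, c₀, hC₀, hc₀, H0⟩ := perPlaquette_boundedHeight_uniform L 0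
  -- degenerate block size: no family has `F.L = L < 2`
  by_cases hL : 2 ≤ L
  swap
  · refine ⟨1, 0, 1, one_pos, le_rfl, le_rfl, one_pos, fun F γ hFL => ?_⟩
    exact absurd (hFL ▸ F.hL.2) (by omega)
  set c₁ : ℝ := cc / (4624 * (CL + 1) ^ 2) with hc₁
  have hc₁pos : 0 < c₁ := by positivity
  obtain ⟨γη, hγη, hγη1, Hη⟩ := eta_small hCc hc₁pos hb₀ (by linarith : (1 : ℝ) ≤ p₀) (by omega : 1 ≤ L)
  obtain ⟨γA, hγA, hγA1, HA⟩ := localGood_budget hL hb₀ (by linarith : (1 : ℝ) ≤ p₀)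
    (by norm_num : (0 : ℝ) ≤ 9 * 129 ^ 3) hC₀ hc₀ hCc hc₁pos
  refine ⟨min γC (min γLip (min γM (min γA (min γη (1 / 2))))), Cc, c₁, by positivity, (min_le_left _ _).trans hγC1, hCc, hc₁pos,
    fun F γ hFL hγ hγle K => ?_⟩
  have hγC' : γ ≤ γC := hγle.trans (min_le_left _ _)
  have hγLip' : γ ≤ γLip := hγle.trans ((min_le_right _ _).trans (min_le_left _ _))
  have hγM' : γ ≤ γM := hγle.trans ((min_le_right _ _).trans ((min_le_right _ _).trans (min_le_left _ _)))
  have hγA' : γ ≤ γA :=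
    hγle.trans ((min_le_right _ _).trans ((min_le_right _ _).trans ((min_le_right _ _).trans (min_le_left _ _))))
  have hγη' : γ ≤ γη :=
    hγle.trans ((min_le_right _ _).trans ((min_le_right _ _).trans ((min_le_right _ _).trans ((min_le_right _ _).trans (min_le_left _ _)))))
  have hγ2 : γ ≤ 1 / 2 :=
    hγle.trans ((min_le_right _ _).trans ((min_le_right _ _).trans ((min_le_right _ _).trans ((min_le_right _ _).trans (min_le_right _ _)))))
  have hγ1 : γ ≤ 1 := by linarith
  subst hFL
  haveI := isProbabilityMeasure_gibbsK F ℰp hγ.le K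
  have hβ : (F.scheme ℰp γ).β K = (γ * ((F.L : ℝ)⁻¹) ^ K)⁻¹ := rfl
  -- strong induction on the level `j`
  intro j
  induction j using Nat.strong_induction_on with
  | _ j ih =>
  intro hj hjK a
  -- the complement of the local good set is rare
  have hGc : (gibbsK F ℰp γ K).real {U : GaugeField (F.P K) 0 (Matrix.specialUnitaryGroup (Fin 2) ℂ) | (∀ (i : ℕ) (q : Plaq (F.P K) i), i < j → Site.tdist (fun k => ((((q.src k).val * F.L ^ i : ℕ)) : ZMod ((F.P K).sitesPerDir 0))) (fun k => ((((a.src k).val * F.L ^ j : ℕ)) : ZMod ((F.P K).sitesPerDir 0))) + 64 * F.L ^ i ≤ 64 * F.L ^ j → GaugeGroup.dist1 (GaugeField.plaqHol (Averaging.iter (fun i' => BlockAveraging.blockAvg (P := F.P K) (j := i') ℰp) i U) q) < θBal F.L γ b₀ p₀ (K - i))}ᶜ ≤ 1 / 4 := by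
    have hcov := compl_localGood_subset F (X := GaugeField (F.P K) 0 (Matrix.specialUnitaryGroup (Fin 2) ℂ)) K j a
      (fun i q U => GaugeGroup.dist1 (GaugeField.plaqHol (Averaging.iter (fun i' => BlockAveraging.blockAvg (P := F.P K) (j := i') ℰp) i U) q)) (fun i => θBal F.L γ b₀ p₀ (K - i))
    beta_reduce at hcov
    -- level 0: the tree's volume-uniform finest-level tail
    have h0 : ∀ q : Plaq (F.P K) 0, (gibbsK F ℰp γ K).real ({U : GaugeField (F.P K) 0 (Matrix.specialUnitaryGroup (Fin 2) ℂ) | θBal F.L γ b₀ p₀ (K - 0) ≤ GaugeGroup.dist1 (GaugeField.plaqHol (Averaging.iter (fun i' => BlockAveraging.blockAvg (P := F.P K) (j := i') ℰp) 0 U) q)} ∩ {U : GaugeField (F.P K) 0 (Matrix.specialUnitaryGroup (Fin 2) ℂ) | (∀ (i' : ℕ) (q' : Plaq (F.P K) i'), i' < 0 → Site.tdist (fun k => ((((q'.src k).val * F.L ^ i' : ℕ)) : ZMod ((F.P K).sitesPerDir 0))) (fun k => ((((q.src k).val * F.L ^ 0 : ℕ)) : ZMod ((F.P K).sitesPerDir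 0))) + 64 * F.L ^ i' ≤ 64 * F.L ^ 0 → GaugeGroup.dist1 (GaugeField.plaqHol (Averaging.iter (fun i' => BlockAveraging.blockAvg (P := F.P K) (j := i') ℰp) i' U) q') < θBal F.L γ b₀ p₀ (K - i'))}) ≤
        C₀ * ((γ * ((F.L : ℝ)⁻¹) ^ K)⁻¹) ^ 5 * Real.exp (-(c₀ * B10.pFun b₀ p₀ (Real.sqrt (γ * ((F.L : ℝ)⁻¹) ^ (K))) ^ 2)) := by
      intro q
      have h := H0 F rfl γ hγ hγ1 b₀ hb₀.le p₀ K 0 (Nat.zero_le K) le_rfl q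
      simp only [Nat.sub_zero] at h
      rw [hβ] at h
      exact (measureReal_mono Set.inter_subset_left (measure_ne_top _ _)).trans h
    -- levels `1 ≤ i < j`: the induction hypothesis
    have hi : ∀ i ∈ Finset.Ico 1 j, ∀ q : Plaq (F.P K) i, (gibbsK F ℰp γ K).real ({U : GaugeField (F.P K) 0 (Matrix.specialUnitaryGroup (Fin 2) ℂ) | θBal F.L γ b₀ p₀ (K - i) ≤ GaugeGroup.dist1 (GaugeField.plaqHol (Averaging.iter (fun i' => BlockAveraging.blockAvg (P := F.P K) (j := i') ℰp) i U) q)} ∩ {U : GaugeField (F.P K) 0 (Matrix.specialUnitaryGroup (Fin 2) ℂ) | (∀ (i' : ℕ) (q' : Plaq (F.P K) i'), i' < i → Site.tdist (fun k => ((((q'.src k).val * F.L ^ i' : ℕ)) : ZMod ((F.P K).sitesPerDir 0))) (fun k => ((((q.src k).val * F.L ^ i : ℕ)) : ZMod ((F.P K).sitesPerDir 0))) + 64 * F.L ^ i' ≤ 64 * F.L ^ i → GaugeGroup.dist1 (GaugeField.plaqHol (Averaging.iter (fun i' => BlockAveraging.blockAvg (P := F.P K) (j := i') ℰp) i' U)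 q') < θBal F.L γ b₀ p₀ (K - i'))}) ≤
        Cc * Real.exp (-(c₁ * B10.pFun b₀ p₀ (Real.sqrt (γ * ((F.L : ℝ)⁻¹) ^ (K - i))) ^ 2)) := by
      intro i hi q
      rw [Finset.mem_Ico] at hi
      exact ih i hi.2 hi.1 (by omega) q
    -- the counts
    have hN : ∀ i, i ≤ j → (((Finset.univ.filter fun q : Plaq (F.P K) i => Site.tdist (fun k => ((((q.src k).val * F.L ^ i : ℕ)) : ZMod ((F.P K).sitesPerDir 0))) (fun k => ((((a.src k).val * F.L ^ j : ℕ)) : ZMod ((F.P K).sitesPerDir 0))) + 64 * F.L ^ i ≤ 64 * F.L ^ j)).card : ℝ) ≤ 9 * 129 ^ 3 * ((F.L : ℝ) ^ (j - i)) ^ 3 :=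
      fun i hij => card_near_le_real F hij (by omega) a
    calc (gibbsK F ℰp γ K).real {U : GaugeField (F.P K) 0 (Matrix.specialUnitaryGroup (Fin 2) ℂ) | (∀ (i : ℕ) (q : Plaq (F.P K) i), i < j → Site.tdist (fun k => ((((q.src k).val * F.L ^ i : ℕ)) : ZMod ((F.P K).sitesPerDir 0))) (fun k => ((((a.src k).val * F.L ^ j : ℕ)) : ZMod ((F.P K).sitesPerDir 0))) + 64 * F.L ^ i ≤ 64 * F.L ^ j → GaugeGroup.dist1 (GaugeField.plaqHol (Averaging.iter (fun i' => BlockAveraging.blockAvg (P := F.P K) (j := i') ℰp) i U) q) < θBal F.L γ b₀ p₀ (K - i))}ᶜ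
        ≤ (gibbsK F ℰp γ K).real (⋃ i ∈ Finset.range j, ⋃ q ∈ (Finset.univ.filter fun q : Plaq (F.P K) i => Site.tdist (fun k => ((((q.src k).val * F.L ^ i : ℕ)) : ZMod ((F.P K).sitesPerDir 0))) (fun k => ((((a.src k).val * F.L ^ j : ℕ)) : ZMod ((F.P K).sitesPerDir 0))) + 64 * F.L ^ i ≤ 64 * F.L ^ j), ({U : GaugeField (F.P K) 0 (Matrix.specialUnitaryGroup (Fin 2) ℂ) | θBal F.L γ b₀ p₀ (K - i) ≤ GaugeGroup.dist1 (GaugeField.plaqHol (Averaging.iter (fun i' => BlockAveraging.blockAvg (P := F.P K) (j := i') ℰp) i U) q)} ∩ {U : GaugeField (F.P K) 0 (Matrix.specialUnitaryGroup (Fin 2) ℂ) | (∀ (i' : ℕ) (q' : Plaq (F.P K) i'), i' < i → Site.tdist (fun k => ((((q'.src k).val * F.L ^ i' : ℕ)) : ZMod ((F.P K).sitesPerDir 0))) (fun k => ((((q.src k).val * F.L ^ i : ℕ)) : ZMod ((F.P K).sitesPerDir 0))) + 64 * F.L ^ i' ≤ 64 * F.L ^ i → GaugeGroup.dist1 (GaugeField.plaqHol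 (Averaging.iter (fun i' => BlockAveraging.blockAvg (P := F.P K) (j := i') ℰp) i' U) q') < θBal F.L γ b₀ p₀ (K - i'))})) :=
          measureReal_mono hcov (measure_ne_top _ _)
      _ ≤ ∑ i ∈ Finset.range j, (gibbsK F ℰp γ K).real (⋃ q ∈ (Finset.univ.filter fun q : Plaq (F.P K) i => Site.tdist (fun k => ((((q.src k).val * F.L ^ i : ℕ)) : ZMod ((F.P K).sitesPerDir 0))) (fun k => ((((a.src k).val * F.L ^ j : ℕ)) : ZMod ((F.P K).sitesPerDir 0))) + 64 * F.L ^ i ≤ 64 * F.L ^ j), ({U : GaugeField (F.P K) 0 (Matrix.specialUnitaryGroup (Fin 2) ℂ) | θBal F.L γ b₀ p₀ (K - i) ≤ GaugeGroup.dist1 (GaugeField.plaqHol (Averaging.iter (fun i' => BlockAveraging.blockAvg (P := F.P K) (j := i') ℰp) i U) q)} ∩ {U : GaugeField (F.P K) 0 (Matrix.specialUnitaryGroup (Fin 2) ℂ) | (∀ (i' : ℕ) (q' : Plaq (F.P K) i'), i' < i → Site.tdist (fun k => ((((q'.src k).val * F.L ^ i' : ℕ)) : ZMod ((F.P K).sitesPerDir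 0))) (fun k => ((((q.src k).val * F.L ^ i : ℕ)) : ZMod ((F.P K).sitesPerDir 0))) + 64 * F.L ^ i' ≤ 64 * F.L ^ i → GaugeGroup.dist1 (GaugeField.plaqHol (Averaging.iter (fun i' => BlockAveraging.blockAvg (P := F.P K) (j := i') ℰp) i' U) q') < θBal F.L γ b₀ p₀ (K - i'))})) :=
          measureReal_biUnion_finset_le _ _
      _ ≤ ∑ i ∈ Finset.range j, ∑ q ∈ (Finset.univ.filter fun q : Plaq (F.P K) i => Site.tdist (fun k => ((((q.src k).val * F.L ^ i : ℕ)) : ZMod ((F.P K).sitesPerDir 0))) (fun k => ((((a.src k).val * F.L ^ j : ℕ)) : ZMod ((F.P K).sitesPerDir 0))) + 64 * F.L ^ i ≤ 64 * F.L ^ j), (gibbsK F ℰp γ K).real ({U : GaugeField (F.P K) 0 (Matrix.specialUnitaryGroup (Fin 2) ℂ) | θBal F.L γ b₀ p₀ (K - i) ≤ GaugeGroup.dist1 (GaugeField.plaqHol (Averaging.iter (fun i' => BlockAveraging.blockAvg (P := F.P K) (j := i') ℰp) i U) q)} ∩ {U : GaugeField (F.P K) 0 (Matrix.specialUnitaryGroup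 (Fin 2) ℂ) | (∀ (i' : ℕ) (q' : Plaq (F.P K) i'), i' < i → Site.tdist (fun k => ((((q'.src k).val * F.L ^ i' : ℕ)) : ZMod ((F.P K).sitesPerDir 0))) (fun k => ((((q.src k).val * F.L ^ i : ℕ)) : ZMod ((F.P K).sitesPerDir 0))) + 64 * F.L ^ i' ≤ 64 * F.L ^ i → GaugeGroup.dist1 (GaugeField.plaqHol (Averaging.iter (fun i' => BlockAveraging.blockAvg (P := F.P K) (j := i') ℰp) i' U) q') < θBal F.L γ b₀ p₀ (K - i'))}) :=
          Finset.sum_le_sum fun i _ => measureReal_biUnion_finset_le _ _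
      _ = ∑ q ∈ (Finset.univ.filter fun q : Plaq (F.P K) 0 => Site.tdist (fun k => ((((q.src k).val * F.L ^ 0 : ℕ)) : ZMod ((F.P K).sitesPerDir 0))) (fun k => ((((a.src k).val * F.L ^ j : ℕ)) : ZMod ((F.P K).sitesPerDir 0))) + 64 * F.L ^ 0 ≤ 64 * F.L ^ j), (gibbsK F ℰp γ K).real ({U : GaugeField (F.P K) 0 (Matrix.specialUnitaryGroup (Fin 2) ℂ) | θBal F.L γ b₀ p₀ (K - 0) ≤ GaugeGroup.dist1 (GaugeField.plaqHol (Averaging.iter (fun i' => BlockAveraging.blockAvg (P := F.P K) (j := i') ℰp) 0 U) q)} ∩ {U : GaugeField (F.P K) 0 (Matrix.specialUnitaryGroup (Fin 2) ℂ) | (∀ (i' : ℕ) (q' : Plaq (F.P K) i'), i' < 0 → Site.tdist (fun k => ((((q'.src k).val * F.L ^ i' : ℕ)) : ZMod ((F.P K).sitesPerDir 0))) (fun k => ((((q.src k).val * F.L ^ 0 : ℕ)) : ZMod ((F.P K).sitesPerDir 0))) + 64 * F.L ^ i' ≤ 64 * F.L ^ 0 → GaugeGroup.dist1 (GaugeField.plaqHol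 (Averaging.iter (fun i' => BlockAveraging.blockAvg (P := F.P K) (j := i') ℰp) i' U) q') < θBal F.L γ b₀ p₀ (K - i'))}) +
            ∑ i ∈ Finset.Ico 1 j, ∑ q ∈ (Finset.univ.filter fun q : Plaq (F.P K) i => Site.tdist (fun k => ((((q.src k).val * F.L ^ i : ℕ)) : ZMod ((F.P K).sitesPerDir 0))) (fun k => ((((a.src k).val * F.L ^ j : ℕ)) : ZMod ((F.P K).sitesPerDir 0))) + 64 * F.L ^ i ≤ 64 * F.L ^ j), (gibbsK F ℰp γ K).real ({U : GaugeField (F.P K) 0 (Matrix.specialUnitaryGroup (Fin 2) ℂ) | θBal F.L γ b₀ p₀ (K - i) ≤ GaugeGroup.dist1 (GaugeField.plaqHol (Averaging.iter (fun i' => BlockAveraging.blockAvg (P := F.P K) (j := i') ℰp) i U) q)} ∩ {U : GaugeField (F.P K) 0 (Matrix.specialUnitaryGroup (Fin 2) ℂ) | (∀ (i' : ℕ) (q' : Plaq (F.P K) i'), i' < i → Site.tdist (fun k => ((((q'.src k).val * F.L ^ i' : ℕ)) : ZMod ((F.P K).sitesPerDir 0))) (fun k => ((((q.src k).val * F.L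 ^ i : ℕ)) : ZMod ((F.P K).sitesPerDir 0))) + 64 * F.L ^ i' ≤ 64 * F.L ^ i → GaugeGroup.dist1 (GaugeField.plaqHol (Averaging.iter (fun i' => BlockAveraging.blockAvg (P := F.P K) (j := i') ℰp) i' U) q') < θBal F.L γ b₀ p₀ (K - i'))}) := by
          rw [Finset.range_eq_Ico, Finset.sum_eq_sum_Ico_succ_bot hj]
      _ ≤ 9 * 129 ^ 3 * ((F.L : ℝ) ^ j) ^ 3 * (C₀ * ((γ * ((F.L : ℝ)⁻¹) ^ K)⁻¹) ^ 5 * Real.exp (-(c₀ * B10.pFun b₀ p₀ (Real.sqrt (γ * ((F.L : ℝ)⁻¹) ^ (K))) ^ 2))) +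
            ∑ i ∈ Finset.Ico 1 j, 9 * 129 ^ 3 * ((F.L : ℝ) ^ (j - i)) ^ 3 * (Cc * Real.exp (-(c₁ * B10.pFun b₀ p₀ (Real.sqrt (γ * ((F.L : ℝ)⁻¹) ^ (K - i))) ^ 2))) := by
          refine add_le_add ?_ (Finset.sum_le_sum fun i hi' => ?_)
          · calc ∑ q ∈ (Finset.univ.filter fun q : Plaq (F.P K) 0 => Site.tdist (fun k => ((((q.src k).val * F.L ^ 0 : ℕ)) : ZMod ((F.P K).sitesPerDir 0))) (fun k => ((((a.src k).val * F.L ^ j : ℕ)) : ZMod ((F.P K).sitesPerDir 0))) + 64 * F.L ^ 0 ≤ 64 * F.L ^ j), (gibbsK F ℰp γ K).real ({U : GaugeField (F.P K) 0 (Matrix.specialUnitaryGroup (Fin 2) ℂ) | θBal F.L γ b₀ p₀ (K - 0) ≤ GaugeGroup.dist1 (GaugeField.plaqHol (Averaging.iter (fun i' => BlockAveraging.blockAvg (P := F.P K) (j := i') ℰp) 0 U) q)} ∩ {U : GaugeField (F.P K) 0 (Matrix.specialUnitaryGroup (Fin 2) ℂ) | (∀ (i' : ℕ) (q' : Plaq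 (F.P K) i'), i' < 0 → Site.tdist (fun k => ((((q'.src k).val * F.L ^ i' : ℕ)) : ZMod ((F.P K).sitesPerDir 0))) (fun k => ((((q.src k).val * F.L ^ 0 : ℕ)) : ZMod ((F.P K).sitesPerDir 0))) + 64 * F.L ^ i' ≤ 64 * F.L ^ 0 → GaugeGroup.dist1 (GaugeField.plaqHol (Averaging.iter (fun i' => BlockAveraging.blockAvg (P := F.P K) (j := i') ℰp) i' U) q') < θBal F.L γ b₀ p₀ (K - i'))})
                ≤ ∑ q ∈ (Finset.univ.filter fun q : Plaq (F.P K) 0 => Site.tdist (fun k => ((((q.src k).val * F.L ^ 0 : ℕ)) : ZMod ((F.P K).sitesPerDir 0))) (fun k => ((((a.src k).val * F.L ^ j : ℕ)) : ZMod ((F.P K).sitesPerDir 0))) + 64 * F.L ^ 0 ≤ 64 * F.L ^ j), C₀ * ((γ * ((F.L : ℝ)⁻¹) ^ K)⁻¹) ^ 5 * Real.exp (-(c₀ * B10.pFun b₀ p₀ (Real.sqrt (γ * ((F.L : ℝ)⁻¹) ^ (K))) ^ 2)) :=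
                  Finset.sum_le_sum fun q _ => h0 q
              _ = ((Finset.univ.filter fun q : Plaq (F.P K) 0 => Site.tdist (fun k => ((((q.src k).val * F.L ^ 0 : ℕ)) : ZMod ((F.P K).sitesPerDir 0))) (fun k => ((((a.src k).val * F.L ^ j : ℕ)) : ZMod ((F.P K).sitesPerDir 0))) + 64 * F.L ^ 0 ≤ 64 * F.L ^ j)).card * (C₀ * ((γ * ((F.L : ℝ)⁻¹) ^ K)⁻¹) ^ 5 * Real.exp (-(c₀ * B10.pFun b₀ p₀ (Real.sqrt (γ * ((F.L : ℝ)⁻¹) ^ (K))) ^ 2))) := by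
                  rw [Finset.sum_const, nsmul_eq_mul]
              _ ≤ 9 * 129 ^ 3 * ((F.L : ℝ) ^ j) ^ 3 * (C₀ * ((γ * ((F.L : ℝ)⁻¹) ^ K)⁻¹) ^ 5 * Real.exp (-(c₀ * B10.pFun b₀ p₀ (Real.sqrt (γ * ((F.L : ℝ)⁻¹) ^ (K))) ^ 2))) := by
                  have h := hN 0 (Nat.zero_le j)
                  rw [Nat.sub_zero] at h
                  exact mul_le_mul_of_nonneg_right h (by positivity)
          · calc ∑ q ∈ (Finset.univ.filter fun q : Plaq (F.P K) i => Site.tdist (fun k => ((((q.src k).val * F.L ^ i : ℕ)) : ZMod ((F.P K).sitesPerDir 0))) (fun k => ((((a.src k).val * F.L ^ j : ℕ)) : ZMod ((F.P K).sitesPerDir 0))) + 64 * F.L ^ i ≤ 64 * F.L ^ j), (gibbsK F ℰp γ K).real ({U : GaugeField (F.P K) 0 (Matrix.specialUnitaryGroup (Fin 2) ℂ) | θBal F.L γ b₀ p₀ (K - i) ≤ GaugeGroup.dist1 (GaugeField.plaqHol (Averaging.iter (fun i' => BlockAveraging.blockAvg (P := F.P K) (j := i') ℰp) i U) q)} ∩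 {U : GaugeField (F.P K) 0 (Matrix.specialUnitaryGroup (Fin 2) ℂ) | (∀ (i' : ℕ) (q' : Plaq (F.P K) i'), i' < i → Site.tdist (fun k => ((((q'.src k).val * F.L ^ i' : ℕ)) : ZMod ((F.P K).sitesPerDir 0))) (fun k => ((((q.src k).val * F.L ^ i : ℕ)) : ZMod ((F.P K).sitesPerDir 0))) + 64 * F.L ^ i' ≤ 64 * F.L ^ i → GaugeGroup.dist1 (GaugeField.plaqHol (Averaging.iter (fun i' => BlockAveraging.blockAvg (P := F.P K) (j := i') ℰp) i' U) q') < θBal F.L γ b₀ p₀ (K - i'))})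
                ≤ ∑ q ∈ (Finset.univ.filter fun q : Plaq (F.P K) i => Site.tdist (fun k => ((((q.src k).val * F.L ^ i : ℕ)) : ZMod ((F.P K).sitesPerDir 0))) (fun k => ((((a.src k).val * F.L ^ j : ℕ)) : ZMod ((F.P K).sitesPerDir 0))) + 64 * F.L ^ i ≤ 64 * F.L ^ j), Cc * Real.exp (-(c₁ * B10.pFun b₀ p₀ (Real.sqrt (γ * ((F.L : ℝ)⁻¹) ^ (K - i))) ^ 2)) :=
                  Finset.sum_le_sum fun q _ => hi i hi' q
              _ = ((Finset.univ.filter fun q : Plaq (F.P K) i => Site.tdist (fun k => ((((q.src k).val * F.L ^ i : ℕ)) : ZMod ((F.P K).sitesPerDir 0))) (fun k => ((((a.src k).val * F.L ^ j : ℕ)) : ZMod ((F.P K).sitesPerDir 0))) + 64 * F.L ^ i ≤ 64 * F.L ^ j)).card * (Cc * Real.exp (-(c₁ * B10.pFun b₀ p₀ (Real.sqrt (γ * ((F.L : ℝ)⁻¹) ^ (K - i))) ^ 2))) := by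
                  rw [Finset.sum_const, nsmul_eq_mul]
              _ ≤ 9 * 129 ^ 3 * ((F.L : ℝ) ^ (j - i)) ^ 3 * (Cc * Real.exp (-(c₁ * B10.pFun b₀ p₀ (Real.sqrt (γ * ((F.L : ℝ)⁻¹) ^ (K - i))) ^ 2))) :=
                  mul_le_mul_of_nonneg_right (hN i (Finset.mem_Ico.mp hi').2.le) (by positivity)
      _ ≤ 1 / 4 := HA γ hγ hγA' K j (by omega)
  exact local_step_median F hγ hγ2 hb₀ hjK a hCL (HC F γ rfl hγ hγC' K) (HLip' F γ rfl hγ hγLip' K j hj hjK a)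
    (HM F γ rfl hγ hγM' K j hj hjK a) (Hη γ hγ hγη' (K - j)) hGc

/-- ★ **STUB (T) BY TEXT**: the statement of `stub_localTailOfMedian` of the registered LINE 27 skeleton `Cruxes/HistoryTailL/Lines/median_centring.lean`
(sha16 367d7fa8ee91ce1b) — VERBATIM — is a theorem: K1 `MesoscopicConcentrationL`, K2 `BlockLipschitzL` and the quantile (Q) are its HYPOTHESES and stay
open; no crux, rung or summit is proved. -/
theorem localTailOfMedian_proved :
    Summit.QuantumFields.YangMills.Theses.PoincareLipschitz.MesoscopicConcentrationL →
    Summit.QuantumFields.YangMills.Theses.PoincareLipschitz.BlockLipschitzL →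
    (∀ (L : ℕ) (b₀ p₀ : ℝ), 0 < b₀ → 2 < p₀ → ∃ γ₁ : ℝ, 0 < γ₁ ∧ γ₁ ≤ 1 ∧ ∀ (F : T3Family) (γ : ℝ), F.L = L → 0 < γ → γ ≤ γ₁ →
            ∀ (K j : ℕ), 1 ≤ j → j + 2 ≤ K → ∀ a : Plaq (F.P K) j,
              3 / 4 ≤ (gibbsK F ℰp γ K).real {U : GaugeField (F.P K) 0 (Matrix.specialUnitaryGroup (Fin 2) ℂ) | GaugeGroup.dist1 (GaugeField.plaqHol (Averaging.iter (fun i' => BlockAveraging.blockAvg (P := F.P K) (j := i') ℰp) j U) a) ≤ θBal F.L γ b₀ p₀ (K - j) / 8}) →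
    ∀ (L : ℕ) (b₀ p₀ : ℝ), 0 < b₀ → 2 < p₀ → ∃ (γ₁ C c : ℝ), 0 < γ₁ ∧ γ₁ ≤ 1 ∧ 0 ≤ C ∧ 0 < c ∧ ∀ (F : T3Family) (γ : ℝ), F.L = L → 0 < γ → γ ≤ γ₁ →
          ∀ (K j : ℕ), 1 ≤ j → j + 2 ≤ K → ∀ a : Plaq (F.P K) j,
            (gibbsK F ℰp γ K).real ({U : GaugeField (F.P K) 0 (Matrix.specialUnitaryGroup (Fin 2) ℂ) | θBal F.L γ b₀ p₀ (K - j) ≤ GaugeGroup.dist1 (GaugeField.plaqHol (Averaging.iter (fun i' => BlockAveraging.blockAvg (P := F.P K) (j := i') ℰp) j U) a)} ∩ {U : GaugeField (F.P K) 0 (Matrix.specialUnitaryGroup (Fin 2) ℂ) | (∀ (i : ℕ) (q : Plaq (F.P K) i), i < j → Site.tdist (fun k => ((((q.src k).val * F.L ^ i : ℕ)) : ZMod ((F.P K).sitesPerDir 0))) (fun k => ((((a.src k).val * F.L ^ j : ℕ)) : ZMod ((F.P K).sitesPerDir 0))) + 64 * F.L ^ i ≤ 64 * F.L ^ j → GaugeGroup.dist1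 (GaugeField.plaqHol (Averaging.iter (fun i' => BlockAveraging.blockAvg (P := F.P K) (j := i') ℰp) i U) q) < θBal F.L γ b₀ p₀ (K - i))}) ≤
              C * Real.exp (-(c * B10.pFun b₀ p₀ (Real.sqrt (γ * ((F.L : ℝ)⁻¹) ^ (K - j))) ^ 2)) :=
  fun hC hLip hQ L _ _ hb₀ hp₀ => local_tail_median hC hLip hQ L hb₀ hp₀

end Summit.QuantumFields.YangMills.Cruxes.HistoryTailL.MedianCentring

/-!
# LINE 27 «MedianCentring» — support workfile: STUB (M) `stub_meanOfMedian` SORRY-FREE (+ §A = the P4 budget lemmas, copied)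

§A (verbatim copy of `Lines/median_centring_budget.lean`, commit d920b8ae7b09 — Cruxes workfiles are not importable on the farm, so the budget lemmas
travel with this file): `localGood_budget_theta`, `windowTail_le_theta`.
§B `mean_le_half_of_quantile_tail` (generic probability): `0 ≤ f ≤ 2`, `μ{f ≤ θ/8} ≥ 3/4`, `μ({θ ≤ f} ∩ G) ≤ θ/32`, `μ(Gᶜ) ≤ θ/32` ⇒ `∫ f ≤ θ/2`
(pointwise `f ≤ θ/8 + θ·1_{θ/8<f} + 2·1_{θ≤f}`).  NO McShane proxy is needed for the mean step.
§C `mean_of_median : (Q) → (T-conclusion) → mean ≤ θ(K−j)/2 at depths 1 ≤ j ≤ K−2` (local-good budget at precision θ/32 via §A, finer-level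
tails from (T) itself, level 0 from ✓`perPlaquette_boundedHeight_uniform`) and `meanOfMedian_proved` = the statement of `stub_meanOfMedian` of the
registered skeleton `Lines/median_centring.lean` (sha16 367d7fa8ee91ce1b) VERBATIM.  With `Lines/median_centring_localtail.lean` (stub (T) sorry-free,
commit 6a018803b609) the LINE 27 skeleton reduces to its ONE open stub (Q) `stub_quantileDeviation` (+ the open cruxes K1 `MesoscopicConcentrationL`,
K2 `BlockLipschitzL`, hypotheses of (T)).  No crux, rung (R3 = YM₃ on T³; NOT d = 4, NOT Clay) or summit is proved; the Yang–Mills mass gap is NOT proved.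
-/

/-!
# LINE 27 «MedianCentring» — support workfile: the LOCAL-GOOD BUDGET AT PRECISION `θ(K−j)/M` (critic #320, price P4: «γ_B scalar lemma first»)

✓`localGood_budget` (PoincareLipschitzTwoSidedOfConcentrationBudget) bounds the union-bound mass of the complement of the local good event
`G(a,j)` by `1/4` for `γ ≤ γ_A`.  Stub (M) `stub_meanOfMedian` of `Cruxes/HistoryTailL/Lines/median_centring.lean` re-runs that budget at precision
`θ(K−j)/16` (and needs the level-`j` window tail `C·e^{−c p(g_(K−j))²} ≤ θ(K−j)/16` as well).  THIS FILE proves both scalar facts, for an arbitrary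
divisor `M ≥ 1`, sorry-free:

* `localGood_budget_theta` — the SAME left-hand side as ✓`localGood_budget`, bounded by `θBal L γ b₀ p₀ (K − j) / M` for `0 < γ ≤ γ_B(L,b₀,p₀,V,C₀,c₀,Cc,c₁,M)`;
* `windowTail_le_theta` — `C·exp(−c·p(g_(K−j))²) ≤ θBal L γ b₀ p₀ (K − j) / M` for `0 < γ ≤ γ_T`.

Mechanism (as in the landed file, one power sharper): with `x_h = log g_h⁻¹ ≥ X' = 20/(b₀² min(c₀,c₁)) + 1` every term is `≤ const·e^{16x_h − c x_h²}
≤ const·e^{−4x_h} = const·(γL^{−h})²`, and for the heights `h ∈ {K} ∪ {K−i : 1 ≤ i < j}` (all `≥ K−j`) `(γL^{−h})² ≤ γL^{−h}·g_(K−j)²`; summing,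
`total ≤ V(C₀+Cc)·γ·g_(K−j)² ≤ (b₀/M)·g_(K−j) ≤ θ(K−j)/M` because `p(g) ≥ b₀` and `γ ≤ b₀/(M·(V(C₀+Cc)+1))`.
Elementary real analysis; no stub of the skeleton, no crux, rung (R3 = YM₃ on T³; NOT d = 4, NOT Clay) or summit is proved; YM is NOT proved.
-/

set_option autoImplicit false

namespace Summit.QuantumFields.YangMills.Cruxes.HistoryTailL.MedianCentring

open scoped BigOperators
open Literature.MathematicalPhysics.QuantumFieldTheory.Balaban1983to89
open Literature.MathematicalPhysics.QuantumFieldTheory.Balaban1983to89.T3UnitScaleTilt (θBal)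
open Summit.QuantumFields.YangMills.Theorems.PoincareLipschitz.TwoSidedOfConcentration

/-- `b₀·g ≤ θBal = g·p(g)` since `p(g) = b₀(1 + log g⁻¹)^{p₀} ≥ b₀` on `(0,1]` for `p₀ ≥ 0`. [cite: Balaban1985UV3, (7) p.257] -/
theorem coupling_mul_b₀_le_θBal {L : ℕ} (hL : 1 ≤ L) {γ b₀ p₀ : ℝ} (hγ : 0 < γ) (hγ1 : γ ≤ 1) (hb₀ : 0 ≤ b₀) (hp₀ : 0 ≤ p₀) (h : ℕ) :
    b₀ * Real.sqrt (γ * ((L : ℝ)⁻¹) ^ h) ≤ θBal L γ b₀ p₀ h := by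
  obtain ⟨hg, hg1, _, _⟩ := coupling_basic hL hγ hγ1 h
  set g := Real.sqrt (γ * ((L : ℝ)⁻¹) ^ h) with hgdef
  have hx : 0 ≤ Real.log g⁻¹ := B10.log_inv_nonneg_of_le_one hg hg1
  have h1 : (1 : ℝ) ≤ (1 + Real.log g⁻¹) ^ p₀ := Real.one_le_rpow (by linarith) hp₀
  have hp : b₀ ≤ B10.pFun b₀ p₀ g := by
    unfold B10.pFun
    calc b₀ = b₀ * 1 := (mul_one _).symm
      _ ≤ b₀ * (1 + Real.log g⁻¹) ^ p₀ := mul_le_mul_of_nonneg_left h1 hb₀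
  unfold θBal
  rw [← hgdef, mul_comm]
  exact mul_le_mul_of_nonneg_left hp hg.le

/-- The sharper pointwise estimate: for `γ ≤ e^{−2X'}`, `X' = 20/c + 1`, every `A ≤ 16`:
`e^{A x_h}·e^{−c x_h²} ≤ (γL^{−h})²` (`x_h = log g_h⁻¹`, `(γL^{−h})⁻¹ = e^{2x_h}`). [folklore] -/
theorem key_fourth {L : ℕ} (hL : 1 ≤ L) {γ c : ℝ} (hγ : 0 < γ) (hγ1 : γ ≤ 1) (hc : 0 < c)
    (hγX : γ ≤ Real.exp (-(2 * (20 / c + 1)))) (h : ℕ) (A : ℝ) (hA : A ≤ 16) :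
    Real.exp (A * Real.log (Real.sqrt (γ * ((L : ℝ)⁻¹) ^ h))⁻¹) *
        Real.exp (-(c * Real.log (Real.sqrt (γ * ((L : ℝ)⁻¹) ^ h))⁻¹ ^ 2)) ≤ (γ * ((L : ℝ)⁻¹) ^ h) ^ 2 := by
  obtain ⟨hg, hg1, hg2, _⟩ := coupling_basic hL hγ hγ1 h
  have hx := log_inv_coupling_ge hL hγ hγ1 hγX h
  set x := Real.log (Real.sqrt (γ * ((L : ℝ)⁻¹) ^ h))⁻¹ with hxdef
  have hX0 : (0 : ℝ) ≤ 20 / c + 1 := by positivity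
  have hx0 : 0 ≤ x := hX0.trans hx
  -- `c x² ≥ 20 x` since `x ≥ 20/c + 1`
  have hquad : 20 * x ≤ c * x ^ 2 := by
    have h1 : 20 ≤ c * (20 / c + 1) := by
      rw [mul_add, mul_div_cancel₀ _ hc.ne']
      linarith [hc]
    have h2 : c * (20 / c + 1) ≤ c * x := mul_le_mul_of_nonneg_left hx hc.le
    nlinarith
  -- `(γL^{-h})² = e^{-4x}`
  have hsq : (γ * ((L : ℝ)⁻¹) ^ h) ^ 2 = Real.exp (-(4 * x)) := by
    have hinv : (γ * ((L : ℝ)⁻¹) ^ h)⁻¹ = Real.exp (2 * x) := inv_coupling_sq_eq_exp hL hγ hγ1 h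
    have hpos : 0 < γ * ((L : ℝ)⁻¹) ^ h := by rw [← hg2]; exact pow_pos hg 2
    have : γ * ((L : ℝ)⁻¹) ^ h = Real.exp (-(2 * x)) := by
      rw [Real.exp_neg, ← hinv, inv_inv]
    rw [this, ← Real.exp_nat_mul]
    ring_nf
  rw [hsq, ← Real.exp_add]
  exact Real.exp_le_exp.mpr (by nlinarith)

/-- **THE LOCAL-GOOD BUDGET AT PRECISION `θ(K−j)/M` (critic #320 P4, the `γ_B` scalar lemma).**  Same left-hand side as
✓`localGood_budget`; for `L ≥ 2`, `b₀ > 0`, `p₀ ≥ 1`, `V, C₀, Cc ≥ 0`, `c₀, c₁ > 0`, `M ≥ 1` there is `γ_B ∈ (0,1]` with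
`total ≤ θBal L γ b₀ p₀ (K − j) / M` for all `0 < γ ≤ γ_B`, all `K`, all `j ≤ K`. [folklore; adapted from ✓`localGood_budget`] -/
theorem localGood_budget_theta {L : ℕ} (hL : 2 ≤ L) {b₀ p₀ V C₀ c₀ Cc c₁ M : ℝ} (hb₀ : 0 < b₀) (hp₀ : 1 ≤ p₀) (hV : 0 ≤ V)
    (hC₀ : 0 ≤ C₀) (hc₀ : 0 < c₀) (hCc : 0 ≤ Cc) (hc₁ : 0 < c₁) (hM : 1 ≤ M) :
    ∃ γB : ℝ, 0 < γB ∧ γB ≤ 1 ∧ ∀ γ : ℝ, 0 < γ → γ ≤ γB → ∀ K j : ℕ, j ≤ K →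
      V * ((L : ℝ) ^ j) ^ 3 * (C₀ * ((γ * ((L : ℝ)⁻¹) ^ K)⁻¹) ^ 5 *
          Real.exp (-(c₀ * B10.pFun b₀ p₀ (Real.sqrt (γ * ((L : ℝ)⁻¹) ^ K)) ^ 2))) +
        ∑ i ∈ Finset.Ico 1 j, V * ((L : ℝ) ^ (j - i)) ^ 3 *
          (Cc * Real.exp (-(c₁ * B10.pFun b₀ p₀ (Real.sqrt (γ * ((L : ℝ)⁻¹) ^ (K - i))) ^ 2))) ≤
        θBal L γ b₀ p₀ (K - j) / M := by
  have hL1 : 1 ≤ L := by omega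
  have hL' : (1 : ℝ) ≤ L := by exact_mod_cast hL1
  have hM0 : 0 < M := by linarith
  -- the quadratic rate
  set c : ℝ := min c₀ c₁ * b₀ ^ 2 with hc
  have hcpos : 0 < c := mul_pos (lt_min hc₀ hc₁) (pow_pos hb₀ 2)
  set X : ℝ := 20 / c + 1 with hX
  have hX0 : 0 ≤ X := by positivity
  -- the threshold
  set D : ℝ := V * (C₀ + Cc) + 1 with hD
  have hD0 : 0 < D := by positivity
  refine ⟨min 1 (min (Real.exp (-(2 * X))) (b₀ / (M * D))), by positivity,
    min_le_left _ _, fun γ hγ hγA K j hjK => ?_⟩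
  have hγ1 : γ ≤ 1 := hγA.trans (min_le_left _ _)
  have hγX : γ ≤ Real.exp (-(2 * X)) := hγA.trans ((min_le_right _ _).trans (min_le_left _ _))
  have hγD : γ ≤ b₀ / (M * D) := hγA.trans ((min_le_right _ _).trans (min_le_right _ _))
  -- abbreviation: the running coupling squared at height `K - j`
  set G2 : ℝ := γ * ((L : ℝ)⁻¹) ^ (K - j) with hG2
  obtain ⟨hgKj, hgKj1, hgKj2, hG2γ⟩ := coupling_basic hL1 hγ hγ1 (K - j)
  have hG2pos : 0 < G2 := by rw [hG2, ← hgKj2]; exact pow_pos hgKj 2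
  -- heights `h ≥ K - j` have `(γL^{-h})² ≤ γL^{-h} · G2`
  have hsqle : ∀ h : ℕ, K - j ≤ h → (γ * ((L : ℝ)⁻¹) ^ h) ^ 2 ≤ γ * ((L : ℝ)⁻¹) ^ h * G2 := by
    intro h hh
    have hr0 : 0 ≤ (L : ℝ)⁻¹ := inv_nonneg.mpr (by linarith)
    have hr1 : (L : ℝ)⁻¹ ≤ 1 := inv_le_one_of_one_le₀ hL'
    have hmono : ((L : ℝ)⁻¹) ^ h ≤ ((L : ℝ)⁻¹) ^ (K - j) := pow_le_pow_of_le_one hr0 hr1 hh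
    have hnn : 0 ≤ γ * ((L : ℝ)⁻¹) ^ h := mul_nonneg hγ.le (pow_nonneg hr0 h)
    rw [sq, hG2]
    exact mul_le_mul_of_nonneg_left (mul_le_mul_of_nonneg_left hmono hγ.le) hnn
  -- `p(g_h)² ≥ b₀² x_h²`, hence `e^{-cᵢ p²} ≤ e^{-c x²}`
  have hrate : ∀ h : ℕ, ∀ c' : ℝ, min c₀ c₁ ≤ c' →
      Real.exp (-(c' * B10.pFun b₀ p₀ (Real.sqrt (γ * ((L : ℝ)⁻¹) ^ h)) ^ 2)) ≤
        Real.exp (-(c * Real.log (Real.sqrt (γ * ((L : ℝ)⁻¹) ^ h))⁻¹ ^ 2)) := by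
    intro h c' hc'
    obtain ⟨hg, hg1, _, _⟩ := coupling_basic hL1 hγ hγ1 h
    have hp := sq_log_le_pFun_sq (b₀ := b₀) hp₀ hg hg1
    have hmin0 : 0 ≤ min c₀ c₁ := (lt_min hc₀ hc₁).le
    refine Real.exp_le_exp.mpr (neg_le_neg ?_)
    calc c * Real.log (Real.sqrt (γ * ((L : ℝ)⁻¹) ^ h))⁻¹ ^ 2
        = min c₀ c₁ * (b₀ ^ 2 * Real.log (Real.sqrt (γ * ((L : ℝ)⁻¹) ^ h))⁻¹ ^ 2) := by rw [hc]; ring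
      _ ≤ min c₀ c₁ * B10.pFun b₀ p₀ (Real.sqrt (γ * ((L : ℝ)⁻¹) ^ h)) ^ 2 := mul_le_mul_of_nonneg_left hp hmin0
      _ ≤ c' * B10.pFun b₀ p₀ (Real.sqrt (γ * ((L : ℝ)⁻¹) ^ h)) ^ 2 := mul_le_mul_of_nonneg_right hc' (sq_nonneg _)
  -- level-0 term `≤ V C₀ γ G2`
  have hT0 : V * ((L : ℝ) ^ j) ^ 3 * (C₀ * ((γ * ((L : ℝ)⁻¹) ^ K)⁻¹) ^ 5 *
      Real.exp (-(c₀ * B10.pFun b₀ p₀ (Real.sqrt (γ * ((L : ℝ)⁻¹) ^ K)) ^ 2))) ≤ V * C₀ * (γ * G2) := by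
    set x := Real.log (Real.sqrt (γ * ((L : ℝ)⁻¹) ^ K))⁻¹ with hxdef
    have hLj : ((L : ℝ) ^ j) ^ 3 ≤ ((L : ℝ) ^ K) ^ 3 :=
      pow_le_pow_left₀ (by positivity) (pow_le_pow_right₀ hL' hjK) 3
    have hLK : ((L : ℝ) ^ K) ^ 3 ≤ Real.exp (6 * x) := pow_cube_le_exp hL1 hγ hγ1 K
    have hβ : ((γ * ((L : ℝ)⁻¹) ^ K)⁻¹) ^ 5 = Real.exp (10 * x) := by
      rw [inv_coupling_sq_eq_exp hL1 hγ hγ1 K, ← hxdef, ← Real.exp_nat_mul]; ring_nf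
    have hE := hrate K c₀ (min_le_left _ _)
    have hk := key_fourth hL1 hγ hγ1 hcpos hγX K 16 le_rfl
    have hL3 : ((L : ℝ) ^ j) ^ 3 ≤ Real.exp (6 * x) := hLj.trans hLK
    have hK2 := hsqle K (Nat.sub_le K j)
    calc V * ((L : ℝ) ^ j) ^ 3 * (C₀ * ((γ * ((L : ℝ)⁻¹) ^ K)⁻¹) ^ 5 *
          Real.exp (-(c₀ * B10.pFun b₀ p₀ (Real.sqrt (γ * ((L : ℝ)⁻¹) ^ K)) ^ 2)))
        ≤ V * Real.exp (6 * x) * (C₀ * Real.exp (10 * x) * Real.exp (-(c * x ^ 2))) := by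
          rw [hβ]
          gcongr
      _ = V * C₀ * (Real.exp (16 * x) * Real.exp (-(c * x ^ 2))) := by
          have : Real.exp (16 * x) = Real.exp (6 * x) * Real.exp (10 * x) := by rw [← Real.exp_add]; ring_nf
          rw [this]; ring
      _ ≤ V * C₀ * (γ * ((L : ℝ)⁻¹) ^ K) ^ 2 := by gcongr
      _ ≤ V * C₀ * (γ * ((L : ℝ)⁻¹) ^ K * G2) := by gcongr
      _ ≤ V * C₀ * (γ * G2) := by
          have hlast : γ * ((L : ℝ)⁻¹) ^ K * G2 ≤ γ * G2 :=
            mul_le_mul_of_nonneg_right (coupling_basic hL1 hγ hγ1 K).2.2.2 hG2pos.le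
          gcongr
  -- level-`i` terms `≤ V Cc γ L^{-(K-i)} G2`
  have hTi : ∀ i ∈ Finset.Ico 1 j, V * ((L : ℝ) ^ (j - i)) ^ 3 *
      (Cc * Real.exp (-(c₁ * B10.pFun b₀ p₀ (Real.sqrt (γ * ((L : ℝ)⁻¹) ^ (K - i))) ^ 2))) ≤
        V * Cc * (γ * ((L : ℝ)⁻¹) ^ (K - i) * G2) := by
    intro i hi
    rw [Finset.mem_Ico] at hi
    set x := Real.log (Real.sqrt (γ * ((L : ℝ)⁻¹) ^ (K - i)))⁻¹ with hxdef
    have hLj : ((L : ℝ) ^ (j - i)) ^ 3 ≤ ((L : ℝ) ^ (K - i)) ^ 3 :=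
      pow_le_pow_left₀ (by positivity) (pow_le_pow_right₀ hL' (by omega)) 3
    have hLK : ((L : ℝ) ^ (K - i)) ^ 3 ≤ Real.exp (6 * x) := pow_cube_le_exp hL1 hγ hγ1 (K - i)
    have hE := hrate (K - i) c₁ (min_le_right _ _)
    have hk := key_fourth hL1 hγ hγ1 hcpos hγX (K - i) 6 (by norm_num)
    have hL3 : ((L : ℝ) ^ (j - i)) ^ 3 ≤ Real.exp (6 * x) := hLj.trans hLK
    have hi2 := hsqle (K - i) (by omega)
    calc V * ((L : ℝ) ^ (j - i)) ^ 3 * (Cc * Real.exp (-(c₁ * B10.pFun b₀ p₀ (Real.sqrt (γ * ((L : ℝ)⁻¹) ^ (K - i))) ^ 2)))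
        ≤ V * Real.exp (6 * x) * (Cc * Real.exp (-(c * x ^ 2))) := by
          gcongr
      _ = V * Cc * (Real.exp (6 * x) * Real.exp (-(c * x ^ 2))) := by ring
      _ ≤ V * Cc * (γ * ((L : ℝ)⁻¹) ^ (K - i)) ^ 2 := by gcongr
      _ ≤ V * Cc * (γ * ((L : ℝ)⁻¹) ^ (K - i) * G2) := by gcongr
  -- sum up
  have hsum : ∑ i ∈ Finset.Ico 1 j, V * ((L : ℝ) ^ (j - i)) ^ 3 *
      (Cc * Real.exp (-(c₁ * B10.pFun b₀ p₀ (Real.sqrt (γ * ((L : ℝ)⁻¹) ^ (K - i))) ^ 2))) ≤ V * Cc * (γ * G2) := by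
    calc ∑ i ∈ Finset.Ico 1 j, V * ((L : ℝ) ^ (j - i)) ^ 3 *
          (Cc * Real.exp (-(c₁ * B10.pFun b₀ p₀ (Real.sqrt (γ * ((L : ℝ)⁻¹) ^ (K - i))) ^ 2)))
        ≤ ∑ i ∈ Finset.Ico 1 j, V * Cc * (γ * ((L : ℝ)⁻¹) ^ (K - i) * G2) := Finset.sum_le_sum hTi
      _ = V * Cc * (γ * G2) * ∑ i ∈ Finset.Ico 1 j, ((L : ℝ)⁻¹) ^ (K - i) := by rw [Finset.mul_sum]; ring_nf
      _ ≤ V * Cc * (γ * G2) * 1 := by gcongr; exact sum_Ico_inv_pow_le_one hL hjK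
      _ = V * Cc * (γ * G2) := mul_one _
  -- `V (C₀ + Cc) γ G2 ≤ (b₀/M) · g_(K-j) ≤ θ/M`
  have hθ : b₀ * Real.sqrt G2 ≤ θBal L γ b₀ p₀ (K - j) :=
    coupling_mul_b₀_le_θBal hL1 hγ hγ1 hb₀.le (by linarith) (K - j)
  have hG2le : G2 ≤ Real.sqrt G2 := by
    -- `G2 = g²` with `g ≤ 1`
    rw [hG2, ← hgKj2]
    rw [Real.sqrt_sq hgKj.le]
    calc Real.sqrt (γ * ((L : ℝ)⁻¹) ^ (K - j)) ^ 2
        = Real.sqrt (γ * ((L : ℝ)⁻¹) ^ (K - j)) * Real.sqrt (γ * ((L : ℝ)⁻¹) ^ (K - j)) := sq _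
      _ ≤ Real.sqrt (γ * ((L : ℝ)⁻¹) ^ (K - j)) * 1 := mul_le_mul_of_nonneg_left hgKj1 hgKj.le
      _ = Real.sqrt (γ * ((L : ℝ)⁻¹) ^ (K - j)) := mul_one _
  have hfin : V * C₀ * (γ * G2) + V * Cc * (γ * G2) ≤ θBal L γ b₀ p₀ (K - j) / M := by
    have h1 : V * C₀ * (γ * G2) + V * Cc * (γ * G2) = V * (C₀ + Cc) * γ * G2 := by ring
    rw [h1]
    have h2 : V * (C₀ + Cc) ≤ D := by rw [hD]; linarith
    have h3 : V * (C₀ + Cc) * γ * G2 ≤ D * γ * G2 := by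
      have := mul_le_mul_of_nonneg_right h2 hγ.le
      exact mul_le_mul_of_nonneg_right this hG2pos.le
    have h4 : D * γ ≤ b₀ / M := by
      have := mul_le_mul_of_nonneg_left hγD hD0.le
      have h5 : D * (b₀ / (M * D)) = b₀ / M := by field_simp
      linarith
    have h6 : D * γ * G2 ≤ b₀ / M * Real.sqrt G2 := by
      calc D * γ * G2 ≤ b₀ / M * G2 := mul_le_mul_of_nonneg_right h4 hG2pos.le
        _ ≤ b₀ / M * Real.sqrt G2 := mul_le_mul_of_nonneg_left hG2le (by positivity)
    have h7 : b₀ / M * Real.sqrt G2 = (b₀ * Real.sqrt G2) / M := by ring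
    have h8 : (b₀ * Real.sqrt G2) / M ≤ θBal L γ b₀ p₀ (K - j) / M := div_le_div_of_nonneg_right hθ hM0.le
    linarith
  linarith [hT0, hsum]

/-- **THE LEVEL-`j` WINDOW TAIL AT PRECISION `θ(K−j)/M`.**  For `L ≥ 2`, `b₀ > 0`, `p₀ ≥ 1`, `C ≥ 0`, `c > 0`, `M ≥ 1` there is `γ_T ∈ (0,1]` with
`C·exp(−c·p(g_(K−j))²) ≤ θBal L γ b₀ p₀ (K − j) / M` for all `0 < γ ≤ γ_T`, all `K`, `j ≤ K` (the term `2C·e^{−cp²}` of stub (M)). [folklore] -/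
theorem windowTail_le_theta {L : ℕ} (hL : 2 ≤ L) {b₀ p₀ C c M : ℝ} (hb₀ : 0 < b₀) (hp₀ : 1 ≤ p₀) (hC : 0 ≤ C) (hc : 0 < c)
    (hM : 1 ≤ M) :
    ∃ γT : ℝ, 0 < γT ∧ γT ≤ 1 ∧ ∀ γ : ℝ, 0 < γ → γ ≤ γT → ∀ K j : ℕ, j ≤ K →
      C * Real.exp (-(c * B10.pFun b₀ p₀ (Real.sqrt (γ * ((L : ℝ)⁻¹) ^ (K - j))) ^ 2)) ≤ θBal L γ b₀ p₀ (K - j) / M := by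
  -- the budget theorem with `V := 1`, `C₀ := 0`, `Cc := C`, `c₀ := c₁ := c` at `j + 1 ≤ K + 1`… is not literally this term (heights differ),
  -- so we run the pointwise chain directly.
  have hL1 : 1 ≤ L := by omega
  have hL' : (1 : ℝ) ≤ L := by exact_mod_cast hL1
  have hM0 : 0 < M := by linarith
  set c' : ℝ := c * b₀ ^ 2 with hc'
  have hcpos : 0 < c' := mul_pos hc (pow_pos hb₀ 2)
  set X : ℝ := 20 / c' + 1 with hX
  set D : ℝ := C + 1 with hD
  have hD0 : 0 < D := by positivity
  refine ⟨min 1 (min (Real.exp (-(2 * X))) (b₀ / (M * D))), by positivity,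
    min_le_left _ _, fun γ hγ hγA K j hjK => ?_⟩
  have hγ1 : γ ≤ 1 := hγA.trans (min_le_left _ _)
  have hγX : γ ≤ Real.exp (-(2 * X)) := hγA.trans ((min_le_right _ _).trans (min_le_left _ _))
  have hγD : γ ≤ b₀ / (M * D) := hγA.trans ((min_le_right _ _).trans (min_le_right _ _))
  set G2 : ℝ := γ * ((L : ℝ)⁻¹) ^ (K - j) with hG2
  obtain ⟨hg, hg1, hg2, hG2γ⟩ := coupling_basic hL1 hγ hγ1 (K - j)
  have hG2pos : 0 < G2 := by rw [hG2, ← hg2]; exact pow_pos hg 2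
  set x := Real.log (Real.sqrt (γ * ((L : ℝ)⁻¹) ^ (K - j)))⁻¹ with hxdef
  have hp := sq_log_le_pFun_sq (b₀ := b₀) hp₀ hg hg1
  have hE : Real.exp (-(c * B10.pFun b₀ p₀ (Real.sqrt (γ * ((L : ℝ)⁻¹) ^ (K - j))) ^ 2)) ≤ Real.exp (-(c' * x ^ 2)) := by
    refine Real.exp_le_exp.mpr (neg_le_neg ?_)
    calc c' * x ^ 2 = c * (b₀ ^ 2 * x ^ 2) := by rw [hc']; ring
      _ ≤ c * B10.pFun b₀ p₀ (Real.sqrt (γ * ((L : ℝ)⁻¹) ^ (K - j))) ^ 2 := mul_le_mul_of_nonneg_left hp hc.le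
  have hk := key_fourth hL1 hγ hγ1 hcpos hγX (K - j) 0 (by norm_num)
  rw [zero_mul, Real.exp_zero, one_mul] at hk
  -- `e^{-c p²} ≤ G2² ≤ γ G2`
  have h1 : C * Real.exp (-(c * B10.pFun b₀ p₀ (Real.sqrt (γ * ((L : ℝ)⁻¹) ^ (K - j))) ^ 2)) ≤ C * (γ * G2) := by
    calc C * Real.exp (-(c * B10.pFun b₀ p₀ (Real.sqrt (γ * ((L : ℝ)⁻¹) ^ (K - j))) ^ 2))
        ≤ C * Real.exp (-(c' * x ^ 2)) := mul_le_mul_of_nonneg_left hE hC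
      _ ≤ C * G2 ^ 2 := mul_le_mul_of_nonneg_left hk hC
      _ = C * (G2 * G2) := by rw [sq]
      _ ≤ C * (γ * G2) := mul_le_mul_of_nonneg_left (mul_le_mul_of_nonneg_right hG2γ hG2pos.le) hC
  have hθ : b₀ * Real.sqrt G2 ≤ θBal L γ b₀ p₀ (K - j) :=
    coupling_mul_b₀_le_θBal hL1 hγ hγ1 hb₀.le (by linarith) (K - j)
  have hG2le : G2 ≤ Real.sqrt G2 := by
    rw [hG2, ← hg2, Real.sqrt_sq hg.le]
    calc Real.sqrt (γ * ((L : ℝ)⁻¹) ^ (K - j)) ^ 2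
        = Real.sqrt (γ * ((L : ℝ)⁻¹) ^ (K - j)) * Real.sqrt (γ * ((L : ℝ)⁻¹) ^ (K - j)) := sq _
      _ ≤ Real.sqrt (γ * ((L : ℝ)⁻¹) ^ (K - j)) * 1 := mul_le_mul_of_nonneg_left hg1 hg.le
      _ = Real.sqrt (γ * ((L : ℝ)⁻¹) ^ (K - j)) := mul_one _
  have h2 : C * (γ * G2) ≤ θBal L γ b₀ p₀ (K - j) / M := by
    have h3 : C ≤ D := by rw [hD]; linarith
    have h4 : C * (γ * G2) ≤ D * γ * G2 := by
      have := mul_le_mul_of_nonneg_right h3 (mul_nonneg hγ.le hG2pos.le)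
      linarith [this]
    have h5 : D * γ ≤ b₀ / M := by
      have := mul_le_mul_of_nonneg_left hγD hD0.le
      have h6 : D * (b₀ / (M * D)) = b₀ / M := by field_simp
      linarith
    have h7 : D * γ * G2 ≤ b₀ / M * Real.sqrt G2 := by
      calc D * γ * G2 ≤ b₀ / M * G2 := mul_le_mul_of_nonneg_right h5 hG2pos.le
        _ ≤ b₀ / M * Real.sqrt G2 := mul_le_mul_of_nonneg_left hG2le (by positivity)
    have h8 : b₀ / M * Real.sqrt G2 = (b₀ * Real.sqrt G2) / M := by ring
    have h9 : (b₀ * Real.sqrt G2) / M ≤ θBal L γ b₀ p₀ (K - j) / M := div_le_div_of_nonneg_right hθ hM0.le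
    linarith
  exact h1.trans h2


section MeanStep

open MeasureTheory
open Literature.MathematicalPhysics.QuantumFieldTheory.Balaban1983to89.T3ContinuumYM3Torus
open Literature.MathematicalPhysics.QuantumFieldTheory.Balaban1983to89.T3UnitScaleTilt
open Literature.MathematicalPhysics.QuantumFieldTheory.Balaban1983to89.T3UnitLawDensityEML (ℰp measurableE_ℰp)
open Literature.MathematicalPhysics.QuantumFieldTheory.Balaban1983to89.T3MinimiserStabilityReduction (θBal_pos)
open Literature.MathematicalPhysics.QuantumFieldTheory.Balaban1983to89.T4PairDerivBridge (dist1_le_two_specialUnitaryGroup)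
open Summit.QuantumFields.YangMills.Theorems.HistoryTailBoundedHeightLocal (perPlaquette_boundedHeight_uniform)
open Summit.QuantumFields.YangMills.Theorems.FibreConvexityTail (measurable_dist1_plaqHol_iter)

/-- §B  **Quantile + tail + budget ⇒ mean**, generic: `f ≤ θ/8 + θ·1_{θ/8 < f} + 2·1_{θ ≤ f}` pointwise, integrate. [folklore] -/
theorem mean_le_half_of_quantile_tail {Ω : Type*} [MeasurableSpace Ω] {μ : Measure Ω} [IsProbabilityMeasure μ]
    {f : Ω → ℝ} {G : Set Ω} {θ : ℝ} (hθ : 0 ≤ θ) (hfm : Measurable f) (hf0 : ∀ x, 0 ≤ f x) (hf2 : ∀ x, f x ≤ 2)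
    (hQ : 3 / 4 ≤ μ.real {x | f x ≤ θ / 8}) (hT : μ.real ({x | θ ≤ f x} ∩ G) ≤ θ / 32) (hB : μ.real Gᶜ ≤ θ / 32) :
    ∫ x, f x ∂μ ≤ θ / 2 := by
  have hS1 : MeasurableSet {x | θ / 8 < f x} := measurableSet_lt measurable_const hfm
  have hS2 : MeasurableSet {x | θ ≤ f x} := measurableSet_le measurable_const hfm
  -- pointwise domination
  have hpt : ∀ x, f x ≤ θ / 8 + ({x | θ / 8 < f x}.indicator (fun _ => θ) x + {x | θ ≤ f x}.indicator (fun _ => (2 : ℝ)) x) := by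
    intro x
    have h0 := hf0 x
    have h2' := hf2 x
    by_cases h1 : θ / 8 < f x <;> by_cases h2 : θ ≤ f x <;>
      simp only [Set.indicator, Set.mem_setOf_eq, h1, h2, if_true, if_false] <;> linarith
  -- integrate
  have hint_f : Integrable f μ := (integrable_const (2 : ℝ)).mono' hfm.aestronglyMeasurable
    (ae_of_all _ fun x => by rw [Real.norm_eq_abs, abs_of_nonneg (hf0 x)]; exact hf2 x)
  have hI1 : Integrable ({x | θ / 8 < f x}.indicator fun _ => θ) μ := (integrable_const θ).indicator hS1
  have hI2 : Integrable ({x | θ ≤ f x}.indicator fun _ => (2 : ℝ)) μ := (integrable_const (2 : ℝ)).indicator hS2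
  have hstep : ∫ x, f x ∂μ ≤ θ / 8 + (θ * μ.real {x | θ / 8 < f x} + 2 * μ.real {x | θ ≤ f x}) := by
    calc ∫ x, f x ∂μ
        ≤ ∫ x, (θ / 8 + ({x | θ / 8 < f x}.indicator (fun _ => θ) x + {x | θ ≤ f x}.indicator (fun _ => (2 : ℝ)) x)) ∂μ :=
          integral_mono hint_f ((integrable_const _).add (hI1.add hI2)) hpt
      _ = θ / 8 + (θ * μ.real {x | θ / 8 < f x} + 2 * μ.real {x | θ ≤ f x}) := by
          have hI12 : Integrable (fun x => {x | θ / 8 < f x}.indicator (fun _ => θ) x + {x | θ ≤ f x}.indicator (fun _ => (2 : ℝ)) x) μ :=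
            hI1.add hI2
          rw [integral_add (integrable_const _) hI12, integral_add hI1 hI2, integral_const,
            integral_indicator_const _ hS1, integral_indicator_const _ hS2, smul_eq_mul, smul_eq_mul, smul_eq_mul, probReal_univ]
          ring
  have hq : μ.real {x | θ / 8 < f x} ≤ 1 / 4 := by
    have hS0 : MeasurableSet {x | f x ≤ θ / 8} := measurableSet_le hfm measurable_const
    have h := measureReal_add_measureReal_compl (μ := μ) hS0
    rw [probReal_univ] at h
    have hc : {x | f x ≤ θ / 8}ᶜ = {x | θ / 8 < f x} := by
      ext x; simp [not_le]
    rw [hc] at h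
    linarith
  have ht : μ.real {x | θ ≤ f x} ≤ θ / 32 + θ / 32 := by
    have hcov : {x | θ ≤ f x} ⊆ ({x | θ ≤ f x} ∩ G) ∪ Gᶜ := by
      intro x hx
      by_cases hG : x ∈ G
      · exact Or.inl ⟨hx, hG⟩
      · exact Or.inr hG
    calc μ.real {x | θ ≤ f x} ≤ μ.real (({x | θ ≤ f x} ∩ G) ∪ Gᶜ) := measureReal_mono hcov (measure_ne_top _ _)
      _ ≤ μ.real ({x | θ ≤ f x} ∩ G) + μ.real Gᶜ := measureReal_union_le _ _
      _ ≤ θ / 32 + θ / 32 := add_le_add hT hB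
  have hθq := mul_le_mul_of_nonneg_left hq hθ
  calc ∫ x, f x ∂μ ≤ θ / 8 + (θ * μ.real {x | θ / 8 < f x} + 2 * μ.real {x | θ ≤ f x}) := hstep
    _ ≤ θ / 8 + (θ * (1 / 4) + 2 * (θ / 32 + θ / 32)) := by linarith
    _ = θ / 2 := by ring

/-- §C  **(Q) + (T-conclusion) ⇒ the shallow mean deviation at depths `1 ≤ j ≤ K − 2`.**  Local-good budget at precision `θ/32`
(`localGood_budget_theta`), finer-level tails from the (T) hypothesis itself, level `0` from ✓`perPlaquette_boundedHeight_uniform`, the level-`j`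
window tail `≤ θ/32` (`windowTail_le_theta`), then §B.  [adapted from ✓`local_tail`; cite: Balaban1985UV3, (7) p.257 and (71) p.273] -/
theorem mean_of_median
    (hQ : ∀ (L : ℕ) (b₀ p₀ : ℝ), 0 < b₀ → 2 < p₀ → ∃ γ₁ : ℝ, 0 < γ₁ ∧ γ₁ ≤ 1 ∧ ∀ (F : T3Family) (γ : ℝ), F.L = L → 0 < γ → γ ≤ γ₁ →
          ∀ (K j : ℕ), 1 ≤ j → j + 2 ≤ K → ∀ a : Plaq (F.P K) j,
            3 / 4 ≤ (gibbsK F ℰp γ K).real {U : GaugeField (F.P K) 0 (Matrix.specialUnitaryGroup (Fin 2) ℂ) | GaugeGroup.dist1 (GaugeField.plaqHol (Averaging.iter (fun i' => BlockAveraging.blockAvg (P := F.P K) (j := i') ℰp) j U) a) ≤ θBal F.L γ b₀ p₀ (K - j) / 8})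
    (hT : ∀ (L : ℕ) (b₀ p₀ : ℝ), 0 < b₀ → 2 < p₀ → ∃ (γ₁ C c : ℝ), 0 < γ₁ ∧ γ₁ ≤ 1 ∧ 0 ≤ C ∧ 0 < c ∧ ∀ (F : T3Family) (γ : ℝ), F.L = L → 0 < γ → γ ≤ γ₁ →
          ∀ (K j : ℕ), 1 ≤ j → j + 2 ≤ K → ∀ a : Plaq (F.P K) j,
            (gibbsK F ℰp γ K).real ({U : GaugeField (F.P K) 0 (Matrix.specialUnitaryGroup (Fin 2) ℂ) | θBal F.L γ b₀ p₀ (K - j) ≤ GaugeGroup.dist1 (GaugeField.plaqHol (Averaging.iter (fun i' => BlockAveraging.blockAvg (P := F.P K) (j := i') ℰp) j U) a)} ∩ {U : GaugeField (F.P K) 0 (Matrix.specialUnitaryGroup (Fin 2) ℂ) | (∀ (i : ℕ) (q : Plaq (F.P K) i), i < j → Site.tdist (fun k => ((((q.src k).val * F.L ^ i : ℕ)) : ZMod ((F.P K).sitesPerDir 0))) (fun k => ((((a.src k).val * F.L ^ j : ℕ)) : ZMod ((F.P K).sitesPerDir 0))) + 64 * F.L ^ i ≤ 64 * F.L ^ j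 → GaugeGroup.dist1 (GaugeField.plaqHol (Averaging.iter (fun i' => BlockAveraging.blockAvg (P := F.P K) (j := i') ℰp) i U) q) < θBal F.L γ b₀ p₀ (K - i))}) ≤
              C * Real.exp (-(c * B10.pFun b₀ p₀ (Real.sqrt (γ * ((F.L : ℝ)⁻¹) ^ (K - j))) ^ 2)))
    (L : ℕ) {b₀ p₀ : ℝ} (hb₀ : 0 < b₀) (hp₀ : 2 < p₀) :
    ∃ γ₁ : ℝ, 0 < γ₁ ∧ γ₁ ≤ 1 ∧ ∀ (F : T3Family) (γ : ℝ), F.L = L → 0 < γ → γ ≤ γ₁ →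
      ∀ (K j : ℕ), 1 ≤ j → j + 2 ≤ K → ∀ a : Plaq (F.P K) j,
        ∫ U, GaugeGroup.dist1 (GaugeField.plaqHol (Averaging.iter (fun i' => BlockAveraging.blockAvg (P := F.P K) (j := i') ℰp) j U) a) ∂(gibbsK F ℰp γ K) ≤ θBal F.L γ b₀ p₀ (K - j) / 2 := by
  obtain ⟨γT, Cc, c₁, hγT, hγT1, hCc, hc₁pos, HT⟩ := hT L b₀ p₀ hb₀ hp₀
  obtain ⟨γM, hγM, hγM1, HM⟩ := hQ L b₀ p₀ hb₀ hp₀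
  obtain ⟨C₀, c₀, hC₀, hc₀, H0⟩ := perPlaquette_boundedHeight_uniform L 0
  -- degenerate block size: no family has `F.L = L < 2`
  by_cases hL : 2 ≤ L
  swap
  · refine ⟨1, one_pos, le_rfl, fun F γ hFL => ?_⟩
    exact absurd (hFL ▸ F.hL.2) (by omega)
  obtain ⟨γA, hγA, hγA1, HA⟩ := localGood_budget_theta hL hb₀ (by linarith : (1 : ℝ) ≤ p₀)
    (by norm_num : (0 : ℝ) ≤ 9 * 129 ^ 3) hC₀ hc₀ hCc hc₁pos (by norm_num : (1 : ℝ) ≤ 32)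
  obtain ⟨γW, hγW, hγW1, HW⟩ := windowTail_le_theta hL hb₀ (by linarith : (1 : ℝ) ≤ p₀) hCc hc₁pos (by norm_num : (1 : ℝ) ≤ 32)
  refine ⟨min γT (min γM (min γA (min γW (1 / 2)))), by positivity, (min_le_left _ _).trans hγT1,
    fun F γ hFL hγ hγle K j hj hjK a => ?_⟩
  have hγT' : γ ≤ γT := hγle.trans (min_le_left _ _)
  have hγM' : γ ≤ γM := hγle.trans ((min_le_right _ _).trans (min_le_left _ _))
  have hγA' : γ ≤ γA := hγle.trans ((min_le_right _ _).trans ((min_le_right _ _).trans (min_le_left _ _)))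
  have hγW' : γ ≤ γW :=
    hγle.trans ((min_le_right _ _).trans ((min_le_right _ _).trans ((min_le_right _ _).trans (min_le_left _ _))))
  have hγ2 : γ ≤ 1 / 2 :=
    hγle.trans ((min_le_right _ _).trans ((min_le_right _ _).trans ((min_le_right _ _).trans (min_le_right _ _))))
  have hγ1 : γ ≤ 1 := by linarith
  subst hFL
  haveI := isProbabilityMeasure_gibbsK F ℰp hγ.le K
  have hβ : (F.scheme ℰp γ).β K = (γ * ((F.L : ℝ)⁻¹) ^ K)⁻¹ := rfl
  -- the complement of the local good set has mass ≤ θ/32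
  have hGc : (gibbsK F ℰp γ K).real {U : GaugeField (F.P K) 0 (Matrix.specialUnitaryGroup (Fin 2) ℂ) | (∀ (i : ℕ) (q : Plaq (F.P K) i), i < j → Site.tdist (fun k => ((((q.src k).val * F.L ^ i : ℕ)) : ZMod ((F.P K).sitesPerDir 0))) (fun k => ((((a.src k).val * F.L ^ j : ℕ)) : ZMod ((F.P K).sitesPerDir 0))) + 64 * F.L ^ i ≤ 64 * F.L ^ j → GaugeGroup.dist1 (GaugeField.plaqHol (Averaging.iter (fun i' => BlockAveraging.blockAvg (P := F.P K) (j := i') ℰp) i U) q) < θBal F.L γ b₀ p₀ (K - i))}ᶜ ≤ θBal F.L γ b₀ p₀ (K - j) / 32 := by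
    have hcov := compl_localGood_subset F (X := GaugeField (F.P K) 0 (Matrix.specialUnitaryGroup (Fin 2) ℂ)) K j a
      (fun i q U => GaugeGroup.dist1 (GaugeField.plaqHol (Averaging.iter (fun i' => BlockAveraging.blockAvg (P := F.P K) (j := i') ℰp) i U) q)) (fun i => θBal F.L γ b₀ p₀ (K - i))
    beta_reduce at hcov
    -- level 0: the tree's volume-uniform finest-level tail
    have h0 : ∀ q : Plaq (F.P K) 0, (gibbsK F ℰp γ K).real ({U : GaugeField (F.P K) 0 (Matrix.specialUnitaryGroup (Fin 2) ℂ) | θBal F.L γ b₀ p₀ (K - 0) ≤ GaugeGroup.dist1 (GaugeField.plaqHol (Averaging.iter (fun i' => BlockAveraging.blockAvg (P := F.P K) (j := i') ℰp) 0 U) q)} ∩ {U : GaugeField (F.P K) 0 (Matrix.specialUnitaryGroup (Fin 2) ℂ) | (∀ (i' : ℕ) (q' : Plaq (F.P K) i'), i' < 0 → Site.tdist (fun k => ((((q'.src k).val * F.L ^ i' : ℕ)) : ZMod ((F.P K).sitesPerDir 0))) (fun k => ((((q.src k).val * F.L ^ 0 : ℕ)) : ZMod ((F.P K).sitesPerDir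 0))) + 64 * F.L ^ i' ≤ 64 * F.L ^ 0 → GaugeGroup.dist1 (GaugeField.plaqHol (Averaging.iter (fun i' => BlockAveraging.blockAvg (P := F.P K) (j := i') ℰp) i' U) q') < θBal F.L γ b₀ p₀ (K - i'))}) ≤
        C₀ * ((γ * ((F.L : ℝ)⁻¹) ^ K)⁻¹) ^ 5 * Real.exp (-(c₀ * B10.pFun b₀ p₀ (Real.sqrt (γ * ((F.L : ℝ)⁻¹) ^ (K))) ^ 2)) := by
      intro q
      have h := H0 F rfl γ hγ hγ1 b₀ hb₀.le p₀ K 0 (Nat.zero_le K) le_rfl q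
      simp only [Nat.sub_zero] at h
      rw [hβ] at h
      exact (measureReal_mono Set.inter_subset_left (measure_ne_top _ _)).trans h
    -- levels `1 ≤ i < j`: the window-tail hypothesis (T)
    have hi : ∀ i ∈ Finset.Ico 1 j, ∀ q : Plaq (F.P K) i, (gibbsK F ℰp γ K).real ({U : GaugeField (F.P K) 0 (Matrix.specialUnitaryGroup (Fin 2) ℂ) | θBal F.L γ b₀ p₀ (K - i) ≤ GaugeGroup.dist1 (GaugeField.plaqHol (Averaging.iter (fun i' => BlockAveraging.blockAvg (P := F.P K) (j := i') ℰp) i U) q)} ∩ {U : GaugeField (F.P K) 0 (Matrix.specialUnitaryGroup (Fin 2) ℂ) | (∀ (i' : ℕ) (q' : Plaq (F.P K) i'), i' < i → Site.tdist (fun k => ((((q'.src k).val * F.L ^ i' : ℕ)) : ZMod ((F.P K).sitesPerDir 0))) (fun k => ((((q.src k).val * F.L ^ i : ℕ)) : ZMod ((F.P K).sitesPerDir 0))) + 64 * F.L ^ i' ≤ 64 * F.L ^ i → GaugeGroup.dist1 (GaugeField.plaqHol (Averaging.iter (fun i' => BlockAveraging.blockAvg (P := F.P K) (j := i') ℰp)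 i' U) q') < θBal F.L γ b₀ p₀ (K - i'))}) ≤
        Cc * Real.exp (-(c₁ * B10.pFun b₀ p₀ (Real.sqrt (γ * ((F.L : ℝ)⁻¹) ^ (K - i))) ^ 2)) := by
      intro i hi q
      rw [Finset.mem_Ico] at hi
      exact HT F γ rfl hγ hγT' K i hi.1 (by omega) q
    -- the counts
    have hN : ∀ i, i ≤ j → (((Finset.univ.filter fun q : Plaq (F.P K) i => Site.tdist (fun k => ((((q.src k).val * F.L ^ i : ℕ)) : ZMod ((F.P K).sitesPerDir 0))) (fun k => ((((a.src k).val * F.L ^ j : ℕ)) : ZMod ((F.P K).sitesPerDir 0))) + 64 * F.L ^ i ≤ 64 * F.L ^ j)).card : ℝ) ≤ 9 * 129 ^ 3 * ((F.L : ℝ) ^ (j - i)) ^ 3 :=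
      fun i hij => card_near_le_real F hij (by omega) a
    calc (gibbsK F ℰp γ K).real {U : GaugeField (F.P K) 0 (Matrix.specialUnitaryGroup (Fin 2) ℂ) | (∀ (i : ℕ) (q : Plaq (F.P K) i), i < j → Site.tdist (fun k => ((((q.src k).val * F.L ^ i : ℕ)) : ZMod ((F.P K).sitesPerDir 0))) (fun k => ((((a.src k).val * F.L ^ j : ℕ)) : ZMod ((F.P K).sitesPerDir 0))) + 64 * F.L ^ i ≤ 64 * F.L ^ j → GaugeGroup.dist1 (GaugeField.plaqHol (Averaging.iter (fun i' => BlockAveraging.blockAvg (P := F.P K) (j := i') ℰp) i U) q) < θBal F.L γ b₀ p₀ (K - i))}ᶜ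
        ≤ (gibbsK F ℰp γ K).real (⋃ i ∈ Finset.range j, ⋃ q ∈ (Finset.univ.filter fun q : Plaq (F.P K) i => Site.tdist (fun k => ((((q.src k).val * F.L ^ i : ℕ)) : ZMod ((F.P K).sitesPerDir 0))) (fun k => ((((a.src k).val * F.L ^ j : ℕ)) : ZMod ((F.P K).sitesPerDir 0))) + 64 * F.L ^ i ≤ 64 * F.L ^ j), ({U : GaugeField (F.P K) 0 (Matrix.specialUnitaryGroup (Fin 2) ℂ) | θBal F.L γ b₀ p₀ (K - i) ≤ GaugeGroup.dist1 (GaugeField.plaqHol (Averaging.iter (fun i' => BlockAveraging.blockAvg (P := F.P K) (j := i') ℰp) i U) q)} ∩ {U : GaugeField (F.P K) 0 (Matrix.specialUnitaryGroup (Fin 2) ℂ) | (∀ (i' : ℕ) (q' : Plaq (F.P K) i'), i' < i → Site.tdist (fun k => ((((q'.src k).val * F.L ^ i' : ℕ)) : ZMod ((F.P K).sitesPerDir 0))) (fun k => ((((q.src k).val * F.L ^ i : ℕ)) : ZMod ((F.P K).sitesPerDir 0))) + 64 * F.L ^ i' ≤ 64 * F.L ^ i → GaugeGroup.dist1 (GaugeField.plaqHol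 (Averaging.iter (fun i' => BlockAveraging.blockAvg (P := F.P K) (j := i') ℰp) i' U) q') < θBal F.L γ b₀ p₀ (K - i'))})) :=
          measureReal_mono hcov (measure_ne_top _ _)
      _ ≤ ∑ i ∈ Finset.range j, (gibbsK F ℰp γ K).real (⋃ q ∈ (Finset.univ.filter fun q : Plaq (F.P K) i => Site.tdist (fun k => ((((q.src k).val * F.L ^ i : ℕ)) : ZMod ((F.P K).sitesPerDir 0))) (fun k => ((((a.src k).val * F.L ^ j : ℕ)) : ZMod ((F.P K).sitesPerDir 0))) + 64 * F.L ^ i ≤ 64 * F.L ^ j), ({U : GaugeField (F.P K) 0 (Matrix.specialUnitaryGroup (Fin 2) ℂ) | θBal F.L γ b₀ p₀ (K - i) ≤ GaugeGroup.dist1 (GaugeField.plaqHol (Averaging.iter (fun i' => BlockAveraging.blockAvg (P := F.P K) (j := i') ℰp) i U) q)} ∩ {U : GaugeField (F.P K) 0 (Matrix.specialUnitaryGroup (Fin 2) ℂ) | (∀ (i' : ℕ) (q' : Plaq (F.P K) i'), i' < i → Site.tdist (fun k => ((((q'.src k).val * F.L ^ i' : ℕ)) : ZMod ((F.P K).sitesPerDir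 0))) (fun k => ((((q.src k).val * F.L ^ i : ℕ)) : ZMod ((F.P K).sitesPerDir 0))) + 64 * F.L ^ i' ≤ 64 * F.L ^ i → GaugeGroup.dist1 (GaugeField.plaqHol (Averaging.iter (fun i' => BlockAveraging.blockAvg (P := F.P K) (j := i') ℰp) i' U) q') < θBal F.L γ b₀ p₀ (K - i'))})) :=
          measureReal_biUnion_finset_le _ _
      _ ≤ ∑ i ∈ Finset.range j, ∑ q ∈ (Finset.univ.filter fun q : Plaq (F.P K) i => Site.tdist (fun k => ((((q.src k).val * F.L ^ i : ℕ)) : ZMod ((F.P K).sitesPerDir 0))) (fun k => ((((a.src k).val * F.L ^ j : ℕ)) : ZMod ((F.P K).sitesPerDir 0))) + 64 * F.L ^ i ≤ 64 * F.L ^ j), (gibbsK F ℰp γ K).real ({U : GaugeField (F.P K) 0 (Matrix.specialUnitaryGroup (Fin 2) ℂ) | θBal F.L γ b₀ p₀ (K - i) ≤ GaugeGroup.dist1 (GaugeField.plaqHol (Averaging.iter (fun i' => BlockAveraging.blockAvg (P := F.P K) (j := i') ℰp) i U) q)} ∩ {U : GaugeField (F.P K) 0 (Matrix.specialUnitaryGroup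 (Fin 2) ℂ) | (∀ (i' : ℕ) (q' : Plaq (F.P K) i'), i' < i → Site.tdist (fun k => ((((q'.src k).val * F.L ^ i' : ℕ)) : ZMod ((F.P K).sitesPerDir 0))) (fun k => ((((q.src k).val * F.L ^ i : ℕ)) : ZMod ((F.P K).sitesPerDir 0))) + 64 * F.L ^ i' ≤ 64 * F.L ^ i → GaugeGroup.dist1 (GaugeField.plaqHol (Averaging.iter (fun i' => BlockAveraging.blockAvg (P := F.P K) (j := i') ℰp) i' U) q') < θBal F.L γ b₀ p₀ (K - i'))}) :=
          Finset.sum_le_sum fun i _ => measureReal_biUnion_finset_le _ _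
      _ = ∑ q ∈ (Finset.univ.filter fun q : Plaq (F.P K) 0 => Site.tdist (fun k => ((((q.src k).val * F.L ^ 0 : ℕ)) : ZMod ((F.P K).sitesPerDir 0))) (fun k => ((((a.src k).val * F.L ^ j : ℕ)) : ZMod ((F.P K).sitesPerDir 0))) + 64 * F.L ^ 0 ≤ 64 * F.L ^ j), (gibbsK F ℰp γ K).real ({U : GaugeField (F.P K) 0 (Matrix.specialUnitaryGroup (Fin 2) ℂ) | θBal F.L γ b₀ p₀ (K - 0) ≤ GaugeGroup.dist1 (GaugeField.plaqHol (Averaging.iter (fun i' => BlockAveraging.blockAvg (P := F.P K) (j := i') ℰp) 0 U) q)} ∩ {U : GaugeField (F.P K) 0 (Matrix.specialUnitaryGroup (Fin 2) ℂ) | (∀ (i' : ℕ) (q' : Plaq (F.P K) i'), i' < 0 → Site.tdist (fun k => ((((q'.src k).val * F.L ^ i' : ℕ)) : ZMod ((F.P K).sitesPerDir 0))) (fun k => ((((q.src k).val * F.L ^ 0 : ℕ)) : ZMod ((F.P K).sitesPerDir 0))) + 64 * F.L ^ i' ≤ 64 * F.L ^ 0 → GaugeGroup.dist1 (GaugeField.plaqHol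 (Averaging.iter (fun i' => BlockAveraging.blockAvg (P := F.P K) (j := i') ℰp) i' U) q') < θBal F.L γ b₀ p₀ (K - i'))}) +
            ∑ i ∈ Finset.Ico 1 j, ∑ q ∈ (Finset.univ.filter fun q : Plaq (F.P K) i => Site.tdist (fun k => ((((q.src k).val * F.L ^ i : ℕ)) : ZMod ((F.P K).sitesPerDir 0))) (fun k => ((((a.src k).val * F.L ^ j : ℕ)) : ZMod ((F.P K).sitesPerDir 0))) + 64 * F.L ^ i ≤ 64 * F.L ^ j), (gibbsK F ℰp γ K).real ({U : GaugeField (F.P K) 0 (Matrix.specialUnitaryGroup (Fin 2) ℂ) | θBal F.L γ b₀ p₀ (K - i) ≤ GaugeGroup.dist1 (GaugeField.plaqHol (Averaging.iter (fun i' => BlockAveraging.blockAvg (P := F.P K) (j := i') ℰp) i U) q)} ∩ {U : GaugeField (F.P K) 0 (Matrix.specialUnitaryGroup (Fin 2) ℂ) | (∀ (i' : ℕ) (q' : Plaq (F.P K) i'), i' < i → Site.tdist (fun k => ((((q'.src k).val * F.L ^ i' : ℕ)) : ZMod ((F.P K).sitesPerDir 0))) (fun k => ((((q.src k).val * F.L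 ^ i : ℕ)) : ZMod ((F.P K).sitesPerDir 0))) + 64 * F.L ^ i' ≤ 64 * F.L ^ i → GaugeGroup.dist1 (GaugeField.plaqHol (Averaging.iter (fun i' => BlockAveraging.blockAvg (P := F.P K) (j := i') ℰp) i' U) q') < θBal F.L γ b₀ p₀ (K - i'))}) := by
          rw [Finset.range_eq_Ico, Finset.sum_eq_sum_Ico_succ_bot hj]
      _ ≤ 9 * 129 ^ 3 * ((F.L : ℝ) ^ j) ^ 3 * (C₀ * ((γ * ((F.L : ℝ)⁻¹) ^ K)⁻¹) ^ 5 * Real.exp (-(c₀ * B10.pFun b₀ p₀ (Real.sqrt (γ * ((F.L : ℝ)⁻¹) ^ (K))) ^ 2))) +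
            ∑ i ∈ Finset.Ico 1 j, 9 * 129 ^ 3 * ((F.L : ℝ) ^ (j - i)) ^ 3 * (Cc * Real.exp (-(c₁ * B10.pFun b₀ p₀ (Real.sqrt (γ * ((F.L : ℝ)⁻¹) ^ (K - i))) ^ 2))) := by
          refine add_le_add ?_ (Finset.sum_le_sum fun i hi' => ?_)
          · calc ∑ q ∈ (Finset.univ.filter fun q : Plaq (F.P K) 0 => Site.tdist (fun k => ((((q.src k).val * F.L ^ 0 : ℕ)) : ZMod ((F.P K).sitesPerDir 0))) (fun k => ((((a.src k).val * F.L ^ j : ℕ)) : ZMod ((F.P K).sitesPerDir 0))) + 64 * F.L ^ 0 ≤ 64 * F.L ^ j), (gibbsK F ℰp γ K).real ({U : GaugeField (F.P K) 0 (Matrix.specialUnitaryGroup (Fin 2) ℂ) | θBal F.L γ b₀ p₀ (K - 0) ≤ GaugeGroup.dist1 (GaugeField.plaqHol (Averaging.iter (fun i' => BlockAveraging.blockAvg (P := F.P K) (j := i') ℰp) 0 U) q)} ∩ {U : GaugeField (F.P K) 0 (Matrix.specialUnitaryGroup (Fin 2) ℂ) | (∀ (i' : ℕ) (q' : Plaq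 (F.P K) i'), i' < 0 → Site.tdist (fun k => ((((q'.src k).val * F.L ^ i' : ℕ)) : ZMod ((F.P K).sitesPerDir 0))) (fun k => ((((q.src k).val * F.L ^ 0 : ℕ)) : ZMod ((F.P K).sitesPerDir 0))) + 64 * F.L ^ i' ≤ 64 * F.L ^ 0 → GaugeGroup.dist1 (GaugeField.plaqHol (Averaging.iter (fun i' => BlockAveraging.blockAvg (P := F.P K) (j := i') ℰp) i' U) q') < θBal F.L γ b₀ p₀ (K - i'))})
                ≤ ∑ q ∈ (Finset.univ.filter fun q : Plaq (F.P K) 0 => Site.tdist (fun k => ((((q.src k).val * F.L ^ 0 : ℕ)) : ZMod ((F.P K).sitesPerDir 0))) (fun k => ((((a.src k).val * F.L ^ j : ℕ)) : ZMod ((F.P K).sitesPerDir 0))) + 64 * F.L ^ 0 ≤ 64 * F.L ^ j), C₀ * ((γ * ((F.L : ℝ)⁻¹) ^ K)⁻¹) ^ 5 * Real.exp (-(c₀ * B10.pFun b₀ p₀ (Real.sqrt (γ * ((F.L : ℝ)⁻¹) ^ (K))) ^ 2)) :=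
                  Finset.sum_le_sum fun q _ => h0 q
              _ = ((Finset.univ.filter fun q : Plaq (F.P K) 0 => Site.tdist (fun k => ((((q.src k).val * F.L ^ 0 : ℕ)) : ZMod ((F.P K).sitesPerDir 0))) (fun k => ((((a.src k).val * F.L ^ j : ℕ)) : ZMod ((F.P K).sitesPerDir 0))) + 64 * F.L ^ 0 ≤ 64 * F.L ^ j)).card * (C₀ * ((γ * ((F.L : ℝ)⁻¹) ^ K)⁻¹) ^ 5 * Real.exp (-(c₀ * B10.pFun b₀ p₀ (Real.sqrt (γ * ((F.L : ℝ)⁻¹) ^ (K))) ^ 2))) := by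
                  rw [Finset.sum_const, nsmul_eq_mul]
              _ ≤ 9 * 129 ^ 3 * ((F.L : ℝ) ^ j) ^ 3 * (C₀ * ((γ * ((F.L : ℝ)⁻¹) ^ K)⁻¹) ^ 5 * Real.exp (-(c₀ * B10.pFun b₀ p₀ (Real.sqrt (γ * ((F.L : ℝ)⁻¹) ^ (K))) ^ 2))) := by
                  have h := hN 0 (Nat.zero_le j)
                  rw [Nat.sub_zero] at h
                  exact mul_le_mul_of_nonneg_right h (by positivity)
          · calc ∑ q ∈ (Finset.univ.filter fun q : Plaq (F.P K) i => Site.tdist (fun k => ((((q.src k).val * F.L ^ i : ℕ)) : ZMod ((F.P K).sitesPerDir 0))) (fun k => ((((a.src k).val * F.L ^ j : ℕ)) : ZMod ((F.P K).sitesPerDir 0))) + 64 * F.L ^ i ≤ 64 * F.L ^ j), (gibbsK F ℰp γ K).real ({U : GaugeField (F.P K) 0 (Matrix.specialUnitaryGroup (Fin 2) ℂ) | θBal F.L γ b₀ p₀ (K - i) ≤ GaugeGroup.dist1 (GaugeField.plaqHol (Averaging.iter (fun i' => BlockAveraging.blockAvg (P := F.P K) (j := i') ℰp) i U) q)} ∩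 {U : GaugeField (F.P K) 0 (Matrix.specialUnitaryGroup (Fin 2) ℂ) | (∀ (i' : ℕ) (q' : Plaq (F.P K) i'), i' < i → Site.tdist (fun k => ((((q'.src k).val * F.L ^ i' : ℕ)) : ZMod ((F.P K).sitesPerDir 0))) (fun k => ((((q.src k).val * F.L ^ i : ℕ)) : ZMod ((F.P K).sitesPerDir 0))) + 64 * F.L ^ i' ≤ 64 * F.L ^ i → GaugeGroup.dist1 (GaugeField.plaqHol (Averaging.iter (fun i' => BlockAveraging.blockAvg (P := F.P K) (j := i') ℰp) i' U) q') < θBal F.L γ b₀ p₀ (K - i'))})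
                ≤ ∑ q ∈ (Finset.univ.filter fun q : Plaq (F.P K) i => Site.tdist (fun k => ((((q.src k).val * F.L ^ i : ℕ)) : ZMod ((F.P K).sitesPerDir 0))) (fun k => ((((a.src k).val * F.L ^ j : ℕ)) : ZMod ((F.P K).sitesPerDir 0))) + 64 * F.L ^ i ≤ 64 * F.L ^ j), Cc * Real.exp (-(c₁ * B10.pFun b₀ p₀ (Real.sqrt (γ * ((F.L : ℝ)⁻¹) ^ (K - i))) ^ 2)) :=
                  Finset.sum_le_sum fun q _ => hi i hi' q
              _ = ((Finset.univ.filter fun q : Plaq (F.P K) i => Site.tdist (fun k => ((((q.src k).val * F.L ^ i : ℕ)) : ZMod ((F.P K).sitesPerDir 0))) (fun k => ((((a.src k).val * F.L ^ j : ℕ)) : ZMod ((F.P K).sitesPerDir 0))) + 64 * F.L ^ i ≤ 64 * F.L ^ j)).card * (Cc * Real.exp (-(c₁ * B10.pFun b₀ p₀ (Real.sqrt (γ * ((F.L : ℝ)⁻¹) ^ (K - i))) ^ 2))) := by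
                  rw [Finset.sum_const, nsmul_eq_mul]
              _ ≤ 9 * 129 ^ 3 * ((F.L : ℝ) ^ (j - i)) ^ 3 * (Cc * Real.exp (-(c₁ * B10.pFun b₀ p₀ (Real.sqrt (γ * ((F.L : ℝ)⁻¹) ^ (K - i))) ^ 2))) :=
                  mul_le_mul_of_nonneg_right (hN i (Finset.mem_Ico.mp hi').2.le) (by positivity)
      _ ≤ θBal F.L γ b₀ p₀ (K - j) / 32 := HA γ hγ hγA' K j (by omega)
  -- the level-`j` window tail is ≤ θ/32, and §B
  have hTj := (HT F γ rfl hγ hγT' K j hj hjK a).trans (HW γ hγ hγW' K j (by omega))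
  have hL1 : 1 ≤ F.L := le_of_lt F.hL.2
  exact mean_le_half_of_quantile_tail (θBal_pos hL1 hγ hγ1 hb₀ p₀ (K - j)).le (measurable_dist1_plaqHol_iter F K j a)
    (fun U => GaugeGroup.dist1_nonneg _) (fun U => dist1_le_two_specialUnitaryGroup _) (HM F γ rfl hγ hγM' K j hj hjK a) hTj hGc

/-- ★ **STUB (M) BY TEXT**: the statement of `stub_meanOfMedian` of the registered LINE 27 skeleton `Cruxes/HistoryTailL/Lines/median_centring.lean`
(sha16 367d7fa8ee91ce1b) — VERBATIM — is a theorem (K1, K2 are not even used; (Q) and the (T)-conclusion are the hypotheses).  No crux, rung or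
summit is proved. -/
theorem meanOfMedian_proved :
    Summit.QuantumFields.YangMills.Theses.PoincareLipschitz.MesoscopicConcentrationL →
    Summit.QuantumFields.YangMills.Theses.PoincareLipschitz.BlockLipschitzL →
    (∀ (L : ℕ) (b₀ p₀ : ℝ), 0 < b₀ → 2 < p₀ → ∃ γ₁ : ℝ, 0 < γ₁ ∧ γ₁ ≤ 1 ∧ ∀ (F : T3Family) (γ : ℝ), F.L = L → 0 < γ → γ ≤ γ₁ →
            ∀ (K j : ℕ), 1 ≤ j → j + 2 ≤ K → ∀ a : Plaq (F.P K) j,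
              3 / 4 ≤ (gibbsK F ℰp γ K).real {U : GaugeField (F.P K) 0 (Matrix.specialUnitaryGroup (Fin 2) ℂ) | GaugeGroup.dist1 (GaugeField.plaqHol (Averaging.iter (fun i' => BlockAveraging.blockAvg (P := F.P K) (j := i') ℰp) j U) a) ≤ θBal F.L γ b₀ p₀ (K - j) / 8}) →
    (∀ (L : ℕ) (b₀ p₀ : ℝ), 0 < b₀ → 2 < p₀ → ∃ (γ₁ C c : ℝ), 0 < γ₁ ∧ γ₁ ≤ 1 ∧ 0 ≤ C ∧ 0 < c ∧ ∀ (F : T3Family) (γ : ℝ), F.L = L → 0 < γ → γ ≤ γ₁ →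
            ∀ (K j : ℕ), 1 ≤ j → j + 2 ≤ K → ∀ a : Plaq (F.P K) j,
              (gibbsK F ℰp γ K).real ({U : GaugeField (F.P K) 0 (Matrix.specialUnitaryGroup (Fin 2) ℂ) | θBal F.L γ b₀ p₀ (K - j) ≤ GaugeGroup.dist1 (GaugeField.plaqHol (Averaging.iter (fun i' => BlockAveraging.blockAvg (P := F.P K) (j := i') ℰp) j U) a)} ∩ {U : GaugeField (F.P K) 0 (Matrix.specialUnitaryGroup (Fin 2) ℂ) | (∀ (i : ℕ) (q : Plaq (F.P K) i), i < j → Site.tdist (fun k => ((((q.src k).val * F.L ^ i : ℕ)) : ZMod ((F.P K).sitesPerDir 0))) (fun k => ((((a.src k).val * F.L ^ j : ℕ)) : ZMod ((F.P K).sitesPerDir 0))) + 64 * F.L ^ i ≤ 64 * F.L ^ j → GaugeGroup.dist1 (GaugeField.plaqHol (Averaging.iter (fun i' => BlockAveraging.blockAvg (P := F.P K) (j := i') ℰp) i U) q) < θBal F.L γ b₀ p₀ (K - i))}) ≤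
                C * Real.exp (-(c * B10.pFun b₀ p₀ (Real.sqrt (γ * ((F.L : ℝ)⁻¹) ^ (K - j))) ^ 2))) →
    ∀ (L : ℕ) (b₀ p₀ : ℝ), 0 < b₀ → 2 < p₀ → ∃ γ₁ : ℝ, 0 < γ₁ ∧ γ₁ ≤ 1 ∧ ∀ (F : T3Family) (γ : ℝ), F.L = L → 0 < γ → γ ≤ γ₁ →
          ∀ (K j : ℕ), 1 ≤ j → j + 2 ≤ K → ∀ a : Plaq (F.P K) j,
            ∫ U, GaugeGroup.dist1 (GaugeField.plaqHol (Averaging.iter (fun i' => BlockAveraging.blockAvg (P := F.P K) (j := i') ℰp) j U) a) ∂(gibbsK F ℰp γ K) ≤ θBal F.L γ b₀ p₀ (K - j) / 2 :=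
  fun _ _ hQ hT L _ _ hb₀ hp₀ => mean_of_median hQ hT L hb₀ hp₀

end MeanStep

end Summit.QuantumFields.YangMills.Cruxes.HistoryTailL.MedianCentring

/-!
## §D  THE REGISTERED TARGET OF LINE 27 FROM K1, K2 AND THE ONE OPEN STUB (Q)

`MeanDeviationShallowL_of_quantile : MesoscopicConcentrationL → BlockLipschitzL → (Q) → RevelationMartingale.MeanDeviationShallowL` (stmt-QuantumFields-23133
BY NAME; depth fraction `N₁ := 3`) — the composition `MeanDeviationShallowL_of` of the registered skeleton with (T) := `localTailOfMedian_proved` and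
(M) := `meanOfMedian_proved`.  SORRY-FREE.  K1 (stmt-23532), K2 (stmt-23533) and (Q) are OPEN hypotheses: nothing is closed on the ledger by this file;
it certifies the split `23133 ⇐ 23532 ∧ 23533 ∧ (Q)` for the OWNER / director to act on.  No rung (R3 = YM₃ on T³; NOT d = 4, NOT Clay) or summit is
proved; the Yang–Mills mass gap is NOT proved.
-/

namespace Summit.QuantumFields.YangMills.Cruxes.HistoryTailL.MedianCentring

open MeasureTheory
open Literature.MathematicalPhysics.QuantumFieldTheory.Balaban1983to89
open Literature.MathematicalPhysics.QuantumFieldTheory.Balaban1983to89.T3ContinuumYM3Torus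
open Literature.MathematicalPhysics.QuantumFieldTheory.Balaban1983to89.T3UnitScaleTilt
open Literature.MathematicalPhysics.QuantumFieldTheory.Balaban1983to89.T3UnitLawDensityEML (ℰp)

/-- ★ `RevelationMartingale.MeanDeviationShallowL` (stmt-QuantumFields-23133) from K1, K2 and the quantile statement (Q), sorry-free. -/
theorem MeanDeviationShallowL_of_quantile
    (hC : Summit.QuantumFields.YangMills.Theses.PoincareLipschitz.MesoscopicConcentrationL)
    (hLip : Summit.QuantumFields.YangMills.Theses.PoincareLipschitz.BlockLipschitzL)
    (hQ : ∀ (L : ℕ) (b₀ p₀ : ℝ), 0 < b₀ → 2 < p₀ → ∃ γ₁ : ℝ, 0 < γ₁ ∧ γ₁ ≤ 1 ∧ ∀ (F : T3Family) (γ : ℝ), F.L = L → 0 < γ → γ ≤ γ₁ →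
          ∀ (K j : ℕ), 1 ≤ j → j + 2 ≤ K → ∀ a : Plaq (F.P K) j,
            3 / 4 ≤ (gibbsK F ℰp γ K).real {U : GaugeField (F.P K) 0 (Matrix.specialUnitaryGroup (Fin 2) ℂ) | GaugeGroup.dist1 (GaugeField.plaqHol (Averaging.iter (fun i' => BlockAveraging.blockAvg (P := F.P K) (j := i') ℰp) j U) a) ≤ θBal F.L γ b₀ p₀ (K - j) / 8}) :
    Summit.QuantumFields.YangMills.Theses.RevelationMartingale.MeanDeviationShallowL := by
  intro L
  refine ⟨3, by norm_num, fun b₀ p₀ hb₀ hp₀ => ?_⟩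
  obtain ⟨γ₁, hγ₁, hγ₁1, H⟩ := meanOfMedian_proved hC hLip hQ (localTailOfMedian_proved hC hLip hQ) L b₀ p₀ hb₀ hp₀
  exact ⟨γ₁, hγ₁, hγ₁1, fun F γ hFL hγ hγle K j hj hjK a => H F γ hFL hγ hγle K j hj (by omega) a⟩

end Summit.QuantumFields.YangMills.Cruxes.HistoryTailL.MedianCentring
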